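import Mathlib
import HarnessLib
import Literature.Analysis.FluidPDE.VorticityCalculus
import Summits.NavierStokesRegularity.NavierStokesRegularity.Theses.PoloidalWindowDoor
import Summits.NavierStokesRegularity.NavierStokesRegularity.Theses.LoopPeriodRatchet
import Summits.NavierStokesRegularity.NavierStokesRegularity.Theorems.PoloidalWindowDoorPoloidalWindowRigidityHotLoopsReduction
import Summits.NavierStokesRegularity.NavierStokesRegularity.Theorems.PoloidalWindowDoorPoloidalWindowRigidityFirstIntegral
import Summits.NavierStokesRegularity.NavierStokesRegularity.Theorems.PoloidalWindowDoorPoloidalWindowRigidityHotPlaneConst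
import Summits.NavierStokesRegularity.NavierStokesRegularity.Theorems.PoloidalWindowDoorPoloidalWindowRigidityZeroModeNoHotPlane
import Summits.NavierStokesRegularity.NavierStokesRegularity.Theorems.PoloidalWindowDoorPoloidalWindowRigidityHotSplitRidgeReductions
import Summits.NavierStokesRegularity.NavierStokesRegularity.Theorems.PoloidalWindowDoorPoloidalWindowRigidityHotSplitRidgeKernels
import Summits.NavierStokesRegularity.NavierStokesRegularity.Theorems.PoloidalWindowDoorPoloidalWindowRigidityHotSplitCells
import Summits.NavierStokesRegularity.NavierStokesRegularity.Theorems.PoloidalWindowDoorPoloidalWindowRigidityHotSplitComposition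
import Summits.NavierStokesRegularity.NavierStokesRegularity.Theorems.PoloidalWindowDoorPoloidalWindowRigidityLeafUniformPins
import Summits.NavierStokesRegularity.NavierStokesRegularity.Theorems.PoloidalWindowDoorPoloidalWindowRigidityLeafUniformHFlat
import Summits.NavierStokesRegularity.NavierStokesRegularity.Theorems.PoloidalWindowDoorPoloidalWindowRigidityLeafUniformVortexLine
import Summits.NavierStokesRegularity.NavierStokesRegularity.Theorems.PoloidalWindowDoorPoloidalWindowRigidityLeafUniformLeafEnds
import Summits.NavierStokesRegularity.NavierStokesRegularity.Theorems.PoloidalWindowDoorPoloidalWindowRigidityLeafUniformCurtainInvariant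
import Summits.NavierStokesRegularity.NavierStokesRegularity.Theorems.PoloidalWindowDoorPoloidalWindowRigidityLeafUniformRidgeInvariant
import Summits.NavierStokesRegularity.NavierStokesRegularity.Theorems.PoloidalWindowDoorPoloidalWindowRigidityLeafUniformLeafGlobalLaw
import Summits.NavierStokesRegularity.NavierStokesRegularity.Theorems.PoloidalWindowDoorPoloidalWindowRigidityLeafUniformHotRegularAlone

/-!
# (v1.6 — R18 `hotRegularAlone` DISCHARGED BY NAME from the landed `…Theorems.PoloidalWindowDoorPoloidalWindowRigidityLeafUniformHotRegularAlone.hotRegularAlone` (p701832 + p701918, ns-es-p1 g7 06:16Z); statements byte-identical; sorries 8 → 7 = MORSE-ESCAPING · MORSE-CAPTURED · FLAT-LOOP · FLAT-WEB · C2b′ · S0 · wall — EVERY provable support of LINE 18 is now in the tree BY NAME.)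
# (v1.5 — R11 `curtainInvariant` DISCHARGED BY NAME from the landed `…Theorems.PoloidalWindowDoorPoloidalWindowRigidityLeafUniformCurtainInvariant.curtainInvariant` (ns-es-p1 g7; critic CONFORM-READ 06:10:55Z omission); statements byte-identical to v1.4/v1.3.1; sorries 9 → 8 = R18 · MORSE-ESCAPING · MORSE-CAPTURED · FLAT-LOOP · FLAT-WEB · C2b′ · S0 · wall.)
# (v1.4 — BY-NAME DISCHARGES ONLY, statements untouched: R8 `ridgeInvariant` (p698982 + p699239, ns-es-p1 g7), R9 `hotLapSign` / R10 `hotTimePin` (p694348), R15 `vortexLineGlobal`, R16 `leafGlobalLaw` (`…LeafUniformCurtainCore` + `…LeafUniformLeafGlobalLaw`, ns-es-p1 g7), R19 `leafEnds` (p698325), R20 `hotFlatPointHFlat` (p697413) have LANDED in Theorems as theorems of exactly these statements and are discharged BY NAME (`exact` / es-p1's `fun … =>` wiring), never restated; sorries 16 → 9 = R11 `stub_curtainInvariant` (es-p1 g7 claims it, file ready) · R18 `stub_hotRegularAlone` · the four research cells · C2b′ · S0 · wall.  ideator ns-idea-8 g10, 2026-08-29.)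
# (v1.3.1 — docstrings only: R15 names ONE boundedness source `exists_tube_extension_of_typeI_ancient_mild`; R19 records the PLANARITY answer to critic P1 (hot set ⊆ P₀ by definition). Statements byte-identical to v1.3.)
# (v1.3 — STRUCT-g9-2 (W1): FLAT is DERIVED too. New provable supports R18 `HotRegularAlone` (analytic slice ⇒ near a regular hot point H is one vortex arc; leaf invariant (k,a)), R19 `LeafEnds` (injective, no regular limit points, ends escape or cluster at null points with Δₕw = 0 — Morse OR flat; replaces v1.2's R17), R20 `HotFlatPointHFlat` (Δₕw = 0 at a hot point ⇒ HFlat); R16 restated with the Morse guard only on the curtain law; cells FLAT-ESCAPING / FLAT-CAPTURED; kernels `cellMorseLeaf_of_ends`, `cellFlatLeaf_of_ends` sorry-free; sorries 16 = 9 provable supports + 4 research cells + C2b′ + S0 + wall.)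
# (v1.2 — STRUCT-g9-1: the MORSE cell is DERIVED from MORSE-ESCAPING ∧ MORSE-CAPTURED via three provable supports R15 `VortexLineGlobal` (global vortex lines), R16 `LeafGlobalLaw` (R2+R8+R11 along complete leaves), R17 `MorseLeafEnds` (injective, no recurrence, each end escapes or clusters at FLAT null points); kernel `cellMorseLeaf_of_ends` sorry-free; sorries 9 → 13.)
# (v1.1 — critic A1/A2: HL3′ and the two compositions rewired BY NAME through `…HotSplitCells.peaklessEmpty_of_ridges` / `…HotSplitComposition…_of_residues`; hand-prover notes in the R8/R10 docstrings; mathematics unchanged)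
# Crux `PoloidalWindowRigidity` (K2, stmt-NavierStokesRegularity-19708) + item `LrcModEntire` (stmt-20428) — LINE 18 `leaf_uniform`
# (IDEATOR seat ns-idea-8, generation 9; lens «barrier»; bears_on LADDER-NS N0, rung N0-LocalTubeDoorPoloidal, THICK column; targets the
#  research residue C2a′ `stub_cellC2aRidge` of LINE 15 `hot_split` v1.6 (tree `Lines/hot_split.lean` 0dd9c4b44e10), verbatim.)

**No summit and no crux is proved here.**  `PoloidalWindowRigidity_of_leafUniform` / `LrcModEntire_of_leafUniform` are CONDITIONAL on the sorried
stubs, exactly like every line of the column; the new content is the typed LEAF-UNIFORM STRUCTURE of the hot vortex ridge and a glued dichotomy of C2a′.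

## Why this line (barrier-inversion on census CENSUS-C2-g8 + hot_loops-HL3-census rows C1–C6)

Every attack on the ridge cell C2a′ recorded so far is LOCAL AT A POINT (finite jets at the hot spot — consistent to every order, Cartan–Kähler,
census C1/C2/B-g8-1), AVERAGED (large-scale laws blind to a codimension-2 hot set, B-g8-2/4) or a wrong-signed comparison (B-g8-5).  The statement
«just outside» that class is a law that is UNIFORM ALONG THE WHOLE HOT LEAF `Γ` (the vortex line of hot points) and compares jets at DIFFERENT points
of `Γ`.  Such laws exist and are provable by calculus:

* **R8 ridge invariant** `RidgeInvariant` (hand target, M): along a hot vortex arc `γ`, `I₁ := −Δₕv₂/|ω|²` is CONSTANT: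
  `Δₕv₂(γ τ)·|ω(γ 0)|² = Δₕv₂(γ 0)·|ω(γ τ)|²`.  Proof (3-jet identity, in the frame `ω = |ω|e₀`, `n = e₁` at a point of the arc; `w := v₂(−1,·)`):
  `∇w = 0` and `w = N` along the arc give `w₀₀ = w₀₁ = 0`, `w₀₀₀ = 0`, `(ω·∇)|ω|² = 2|ω|²∂₀ω⁰`; the frozen law `ω·∇w ≡ 0` (all points) differentiated
  twice along `n` gives `w₀₁₁ = −2(∂₁ω¹)w₁₁/|ω|`; hence `(ω·∇)(Δₕw)·|ω|² − Δₕw·(ω·∇)|ω|² = −2w₁₁|ω|²(∂₁ω¹ + ∂₀ω⁰) = −2w₁₁|ω|²·divₕωₕ = 0`, because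
  `divₕωₕ = div ω − ∂₂ω₂ = 0` (`ω₂ ≡ 0`, poloidal).  So `τ ↦ Δₕw(γ τ)/|ω(γ τ)|²` has zero derivative on the arc.  (Instrument I18a, kit j323051, exact
  sympy on a generic local model `w = F(ψ,z)`: `I₁ ≡ −F_ψψ(ψ₀,0)` along the leaf — confirmed.)
* **R9 horizontal Laplace sign on the hot set** `HotLapSign` (hand target, S): `N·Δₕv₂(−1,y) ≤ 0` at every hot `y` (second-order test at a maximum
  of `σv₂(−1,·)`, horizontal directions; the `Pinned` Laplace pin is the instance `y = 0` for the full Laplacian).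
* **R10 time pin on the hot set** `HotTimePin` (hand target, S/M; handed to both cells): `∂ₜv₂(−1,y) = N/2` at EVERY hot `y` (each hot
  point maximises `√(−t)σv₂` over space-time; tree pattern `…HotSpot.hotSpot_firstOrder`, `…LoopTangencyPin`).  With the vertical NS equation at a
  critical point of `v₂` this is the PRESSURE LAW ALONG THE LEAF: `−∂_z p = N/2 − Δₕv₂ − ∂_zz v₂` on all of `Γ`.
* **R11 curtain invariant** `CurtainInvariant` (hand target, L; handed to the Morse cell): on a MORSE arc (`Δₕv₂ ≠ 0`),
  `I₂ := ∂_zz v₂ − |∇ₕ∂_z v₂|²/Δₕv₂` is CONSTANT along the arc.  Proof: by the frozen law `∇ₕw = (∂ₙw) n̂` (`n̂ = Jωₕ/|ωₕ|`), so the ridge surface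
  `S := {∂ₙ̂w = 0}` is an analytic surface through `Γ` transversal to `n̂` (IFT: `∂ₙ̂∂ₙ̂w = Δₕw ≠ 0` on `Γ`), `∇ₕw = 0` on `S`, hence `w` is constant on each
  slice `S ∩ {y₂ = z}` near the arc; call the value `N(z)`.  Differentiating `w(Y(s,z),z) = N(z)` twice in `z` at `z = 0` with `Hessₕw·Y_z + ∇ₕw_z = 0`
  gives `N″(0) = w_zz − |∇ₕw_z|²/Δₕw` at every point of the arc.  (I18a: `I₂ ≡ N″(0) = −29/36` along the leaf of the generic model — confirmed.)
  Consequence with R8/R10 (`Δₕw = −c₀|ω|²`, `c₀ > 0`): along the whole leaf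
  `−σ∂_z p = (|N|/2 − σI₂) + c₀|ω|² + |∇ₕ∂_z v₂|²/(c₀|ω|²) ≥ |N|/2 + 2|∇ₕ∂_z v₂|`, with `σI₂ = σN″(0) ≤ 0` (heights of ridge leaves are maximal at `z = 0`).

## The glued dichotomy (kernel `cellC2aRidge_of_leaf`, sorry-free: real arithmetic on R8 + R9, with R10/R11 handed to the cells)

Split on `Δₕv₂(γ 0) = 0`.  If yes, R8 propagates flatness along the arc: **cell FLAT LEAF** `CellFlatLeaf` (C2a′ + `Δₕv₂ ≡ 0` on the arc, hence — R9 at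
each arc point, NSD with zero trace — the whole horizontal Hessian of `v₂` vanishes along `Γ`: a hot vortex leaf that is flat to second order
transversally, everywhere).  If no, R8 + R9 give `Δₕv₂ = c·|ω|²` along the arc with `N·c < 0`: **cell MORSE LEAF** `CellMorseLeaf` (a uniformly-shaped
analytic ridge: transversal curvature `c₀|ω|²`, ridge surface `S`, curtain invariant `I₂`, pressure law `−σ∂_z p ≥ |N|/2 + 2|∇ₕ∂_z v₂|` on all of `Γ`).
Both cells keep EVERY binder of C2a′ verbatim and add one hypothesis, so each is at most C2a′; `stub_cellC2aRidge` (verbatim statement) is DERIVED.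

Why the cells might still fail / why open: the invariants are kinematic + pin (NS enters through R10 and the pressure law only); a kill must couple
them to a GLOBAL object — recurrence along the leaf (translation limits along `Γ` inherit `c₀`, `I₂`, `A` exactly and can be renormalised so that
`|ω|²|_Γ` is maximal at the new hot spot), the curtain `S` at large `|z|` (`√(−t)N(t,z) ≤ |N|`), or the far field (`|ω| → 0`?) — none is carried out
(CENSUS-C2-g8 B-g8-3: blow-ups and blow-downs at the pin escape the class or lose the window).  The FLAT cell contains the translation limits of Morse leaves
with `c₀|ω|² → 0`; it is the C2a-analogue of thread_axis' flat-threaded residue S3′ (`…LrcModEntireThreadFlatHotSpot`), with flatness now along a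
whole leaf instead of at one point.

## Dead lines avoided (CENSUS-C2-g8 / HL3-census)
Not a finite-jet argument at the hot spot (C1, B-g8-1: R8/R11 are conservation laws BETWEEN points); not an averaged/large-scale law (B-g8-2/4); not
the Harnack/comparison sign (B-g8-5: no maximum principle is invoked); not Clebsch–Monge scalar reduction as a closing mechanism (C4: `ψ` is used only
inside the proofs of R8/R11, the statements are `ψ`-free); not recentring without an improvement step (C2: the invariants ARE the quantities a
recentring along `Γ` now transports — the improvement step itself remains the research content of `CellMorseLeaf`, said so).

## Cheapest falsifier / instrument row
R8 and R11 are refutable by ONE explicit poloidal div-free field with a hot vortex arc violating them (instrument I18a says they hold identically in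
the generic local model; a refuter's cheapest shot is a field where `ωₕ = μ∇ₕ^⊥ψ` with `μ` non-constant along leaves — impossible when `div ω = 0`,
which is exactly the step of the proof).  The cells are refutable only by a class profile (none known: Liouville conjecture).

Imports as hot_split v1.6 (minus the zero-mode files, now reached through `…ZeroModeNoHotPlane`) plus the landed R1–R4/kernels of K2-p2 g13
(`…HotSplitRidgeReductions`, `…HotSplitRidgeKernels`).  `Pinned` / `ThickWindow` / `Peakless` / `hotSet` are VERBATIM local copies (definitionally
equal to hot_split's), so every statement below is the hot_split statement byte-for-byte after unfolding.
-/

open scoped InnerProductSpace RealInnerProductSpace Laplacian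

-- the summit and its single sub-problem share the name (CONVENTIONS §1)
set_option linter.dupNamespace false

namespace Summit.NavierStokesRegularity.NavierStokesRegularity.Cruxes.PoloidalWindowRigidity.LeafUniform

open Set Function MeasureTheory
open Literature.Analysis Literature.Analysis.FluidPDE
open Summit.NavierStokesRegularity.NavierStokesRegularity.Theses.LoopPeriodRatchet
open Summit.NavierStokesRegularity.NavierStokesRegularity.Theses.PoloidalWindowDoor
open Summit.NavierStokesRegularity.NavierStokesRegularity.Theorems

/-! ## The hypothesis packages of HL3′ (VERBATIM hot_split v1.6) -/

/-- **Pinned** — VERBATIM hot_split: Type-I decay, continuity, mild identity, div-free, e₃-poloidal, `N := v₂(−1,0) ≠ 0`, the global bound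
`√(−t)|v₂| ≤ |N|`, `∇v₂(−1,0) = 0`, the time and Laplace pins. -/
def Pinned (C : ℝ) (v : ℝ → EuclideanSpace ℝ (Fin 3) → EuclideanSpace ℝ (Fin 3)) : Prop :=
  Literature.Analysis.FluidPDE.HasTypeITimeDecay C v ∧
  ContinuousOn (Function.uncurry v) (Set.Iio (0 : ℝ) ×ˢ Set.univ) ∧
  (∀ s t : ℝ, s < t → t < 0 → ∀ x, v t x =
    Literature.Analysis.UnboundedOperators.heatExtension (v s) (t - s) x -
      Literature.Analysis.FluidPDE.oseenDuhamel 1 s v v t x) ∧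
  (∀ t < 0, Literature.Analysis.FluidPDE.VectorCalculus.IsDivFree (v t)) ∧
  (∀ s < 0, ∀ y, ⟪Literature.Analysis.FluidPDE.curl (v s) y, EuclideanSpace.single 2 1⟫_ℝ = 0) ∧
  v (-1) 0 2 ≠ 0 ∧ (∀ t < 0, ∀ x, Real.sqrt (-t) * |v t x 2| ≤ |v (-1) 0 2|) ∧
  (∀ h : EuclideanSpace ℝ (Fin 3), fderiv ℝ (v (-1)) 0 h 2 = 0) ∧
  (deriv (fun s => v s 0 2) (-1) = v (-1) 0 2 / 2 ∧ v (-1) 0 2 * (Δ (fun y => v (-1) y 2)) 0 ≤ 0)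

/-- **ThickWindow** — VERBATIM hot_split. -/
def ThickWindow (v : ℝ → EuclideanSpace ℝ (Fin 3) → EuclideanSpace ℝ (Fin 3)) (W : Set (ℝ × EuclideanSpace ℝ (Fin 3))) : Prop :=
  IsOpen W ∧ W ⊆ Set.Iio (0 : ℝ) ×ˢ Set.univ ∧
  (∀ z ∈ W, (Literature.Analysis.FluidPDE.curl (v z.1) z.2 ≠ 0 ∧
      (fderiv ℝ (v z.1) z.2 (EuclideanSpace.single 0 1) 2 ≠ 0 ∨ fderiv ℝ (v z.1) z.2 (EuclideanSpace.single 1 1) 2 ≠ 0) ∧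
      (fderiv ℝ (v z.1) z.2 (EuclideanSpace.single 2 1) 0 ≠ 0 ∨ fderiv ℝ (v z.1) z.2 (EuclideanSpace.single 2 1) 1 ≠ 0)) ∧
    (fderiv ℝ (fun x => fderiv ℝ (v z.1) x (EuclideanSpace.single 2 1) 2) z.2 (EuclideanSpace.single 0 1) *
          fderiv ℝ (v z.1) z.2 (EuclideanSpace.single 1 1) 2 -
        fderiv ℝ (fun x => fderiv ℝ (v z.1) x (EuclideanSpace.single 2 1) 2) z.2 (EuclideanSpace.single 1 1) *
          fderiv ℝ (v z.1) z.2 (EuclideanSpace.single 0 1) 2 ≠ 0)) ∧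
  (∀ m : ℝ → ℝ → ℝ, ∀ W₁ : Set (ℝ × EuclideanSpace ℝ (Fin 3)), W₁ ⊆ W → IsOpen W₁ → W₁.Nonempty →
      ∃ z ∈ W₁, ∃ b : Fin 3, b ≠ 2 ∧
        fderiv ℝ (v z.1) z.2 (EuclideanSpace.single 2 1) b ≠
          m z.1 (z.2 2) * fderiv ℝ (v z.1) z.2 (EuclideanSpace.single b 1) 2) ∧
  (∀ r : ℝ, 0 < r → (Metric.ball ((-1 : ℝ), (0 : EuclideanSpace ℝ (Fin 3))) r ∩ W).Nonempty)

/-- **Peakless** — VERBATIM hot_split: no island bracket of `σ·v₂(s,·)` on any horizontal plane at any time `s < 0`. -/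
def Peakless (v : ℝ → EuclideanSpace ℝ (Fin 3) → EuclideanSpace ℝ (Fin 3)) : Prop :=
  ∀ (s z₀ σ M : ℝ) (K O : Set (EuclideanSpace ℝ (Fin 3))), s < 0 →
    ((σ = 1 ∨ σ = -1) ∧ IsCompact K ∧ K.Nonempty ∧ (∀ y ∈ K, y 2 = z₀ ∧ σ * v s y 2 = M) ∧
      IsOpen O ∧ K ⊆ O ∧ (∀ y ∈ O, y 2 = z₀ → σ * v s y 2 ≤ M) ∧
      (∀ y ∈ O, y 2 = z₀ → σ * v s y 2 = M → y ∈ K)) → False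

/-- The HOT SET of the hot-spot plane `P₀ = {y₂ = 0}` at time `−1` — VERBATIM hot_split: `H := {y : y₂ = 0, v₂(−1,y) = v₂(−1,0)}`. -/
def hotSet (v : ℝ → EuclideanSpace ℝ (Fin 3) → EuclideanSpace ℝ (Fin 3)) : Set (EuclideanSpace ℝ (Fin 3)) :=
  {y | y 2 = 0 ∧ v (-1) y 2 = v (-1) 0 2}

/-! ## The leaf-uniform quantities (second derivatives of `w := v₂(−1,·)` in the column's nested-`fderiv` convention) -/

/-- `∂_b∂_a v₂(−1,·)(y)` — the second derivative of the vertical component of the time-`−1` slice, nested `fderiv` convention of the column. -/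
noncomputable def hess (v : ℝ → EuclideanSpace ℝ (Fin 3) → EuclideanSpace ℝ (Fin 3)) (y a b : EuclideanSpace ℝ (Fin 3)) : ℝ :=
  fderiv ℝ (fun x => fderiv ℝ (fun x' => v (-1) x' 2) x a) y b

/-- `Δₕv₂(−1,·)(y) = ∂₀₀v₂ + ∂₁₁v₂` — the HORIZONTAL Laplacian of the vertical component at time `−1`. -/
noncomputable def lapH (v : ℝ → EuclideanSpace ℝ (Fin 3) → EuclideanSpace ℝ (Fin 3)) (y : EuclideanSpace ℝ (Fin 3)) : ℝ :=
  hess v y (EuclideanSpace.single 0 1) (EuclideanSpace.single 0 1) + hess v y (EuclideanSpace.single 1 1) (EuclideanSpace.single 1 1)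

/-- `I₂(y) := ∂_zz v₂ − |∇ₕ∂_z v₂|²/Δₕv₂` — the CURTAIN quantity (meaningful where `Δₕv₂ ≠ 0`). -/
noncomputable def curtain (v : ℝ → EuclideanSpace ℝ (Fin 3) → EuclideanSpace ℝ (Fin 3)) (y : EuclideanSpace ℝ (Fin 3)) : ℝ :=
  hess v y (EuclideanSpace.single 2 1) (EuclideanSpace.single 2 1) -
    (hess v y (EuclideanSpace.single 2 1) (EuclideanSpace.single 0 1) ^ 2 +
      hess v y (EuclideanSpace.single 2 1) (EuclideanSpace.single 1 1) ^ 2) / lapH v y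

/-- A **hot vortex arc**: the datum of C2a′ — a local integral curve `γ` of `ω(−1,·)` on `(−ε, ε)` inside the hot set, regular at `γ 0`. -/
def IsHotArc (v : ℝ → EuclideanSpace ℝ (Fin 3) → EuclideanSpace ℝ (Fin 3)) (γ : ℝ → EuclideanSpace ℝ (Fin 3)) (ε : ℝ) : Prop :=
  0 < ε ∧ γ 0 ∈ hotSet v ∧ Literature.Analysis.FluidPDE.curl (v (-1)) (γ 0) ≠ 0 ∧
    ∀ τ ∈ Set.Ioo (-ε) ε, HasDerivAt γ (Literature.Analysis.FluidPDE.curl (v (-1)) (γ τ)) τ ∧ γ τ ∈ hotSet v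

/-! ## The provable structure stubs (hand targets) -/

/-- **R8 `RidgeInvariant` (PROVABLE, M; LOAD-BEARING).**  Along a hot vortex arc of a pinned profile with the frozen law, `−Δₕv₂/|ω|²` is constant:
`Δₕv₂(γ τ)·‖ω(γ 0)‖² = Δₕv₂(γ 0)·‖ω(γ τ)‖²` for `τ ∈ (−ε, ε)`.  Proof in the file header (3-jet identity from `divₕωₕ = 0`, the frozen law and
`∇v₂ = 0` on the arc; then the ratio has zero derivative along `γ`; smoothness of the slice from the tree's `contDiff_slice`).
v1.1 note for the hand prover (critic A2): the proof silently needs `ω ≠ 0` ALONG THE WHOLE ARC — get it from `ω(γ 0) ≠ 0` (in `IsHotArc`) and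
uniqueness of integral curves of the C¹ field `curl (v (−1))` (an integral curve through a non-zero never meets a zero; Mathlib ODE uniqueness /
Gronwall), i.e. M-sized bookkeeping before the calculus. -/
def RidgeInvariant : Prop :=
  ∀ (C : ℝ) (v : ℝ → EuclideanSpace ℝ (Fin 3) → EuclideanSpace ℝ (Fin 3)), Pinned C v →
    (∀ s < 0, ∀ y, ⟪fderiv ℝ (v s) y (Literature.Analysis.FluidPDE.curl (v s) y), EuclideanSpace.single 2 1⟫_ℝ = 0) →
    ∀ (γ : ℝ → EuclideanSpace ℝ (Fin 3)) (ε : ℝ), IsHotArc v γ ε →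
      ∀ τ ∈ Set.Ioo (-ε) ε,
        lapH v (γ τ) * ‖Literature.Analysis.FluidPDE.curl (v (-1)) (γ 0)‖ ^ 2 =
          lapH v (γ 0) * ‖Literature.Analysis.FluidPDE.curl (v (-1)) (γ τ)‖ ^ 2

/-- **R8 — DISCHARGED BY NAME (v1.4)**: LANDED as p698982 `…LeafUniformRidgeCore` + p699239 `…LeafUniformRidgeInvariant.ridgeInvariant` (ns-es-p1 g7, `--supports 19708` helper; R8 VERBATIM with `Pinned` / `IsHotArc` / `hotSet` / `lapH` / `hess` unfolded); es-p1's wiring, never restated. -/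
theorem stub_ridgeInvariant : RidgeInvariant := fun C v hP hfr γ ε harc τ hτ =>
  Summit.NavierStokesRegularity.NavierStokesRegularity.Theorems.PoloidalWindowDoorPoloidalWindowRigidityLeafUniformRidgeInvariant.ridgeInvariant C v hP hfr γ ε harc τ hτ

/-- **R9 `HotLapSign` (PROVABLE, S; LOAD-BEARING).**  At every hot point `N·Δₕv₂(−1,y) ≤ 0` (`y` maximises `σv₂(−1,·)` over `ℝ³` by the global
bound at `t = −1`, so every pure second derivative of `σv₂(−1,·)` at `y` is `≤ 0`; tree `contDiff_slice`, second-order test as in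
`…LrcModEntireHigherOrderMaxTest` / `…ThreadPins`). -/
def HotLapSign : Prop :=
  ∀ (C : ℝ) (v : ℝ → EuclideanSpace ℝ (Fin 3) → EuclideanSpace ℝ (Fin 3)), Pinned C v →
    ∀ y ∈ hotSet v, v (-1) 0 2 * lapH v y ≤ 0

/-- **R9 — DISCHARGED BY NAME (v1.4)**: LANDED as p694348 `…LeafUniformPins.hotLapSign` (ns-poloidal-K2-p2 g13; closes the item AS TYPED, critic idea-crit-7 g6 BY-NAME ✓ 04:51Z). -/
theorem stub_hotLapSign : HotLapSign := by
  exact Summit.NavierStokesRegularity.NavierStokesRegularity.Theorems.PoloidalWindowDoorPoloidalWindowRigidityLeafUniformPins.hotLapSign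

/-- **R10 `HotTimePin` (PROVABLE, S/M; LOAD-BEARING: handed to both cells).**  The time pin holds at EVERY hot point:
`∂ₜv₂(−1,y) = N/2` for `y ∈ H` (each hot point maximises `√(−t)σv₂` over `(−∞,0) × ℝ³`; differentiability in `t` of the classical solution; tree
pattern `…HotSpot.hotSpot_firstOrder`).  With vertical NS at a critical point of `v₂`: `−∂_z p(−1,y) = N/2 − Δv₂(−1,y)` on all of `H`.
v1.1 note for the hand prover (critic A2): the statement uses `deriv`, so the proof MUST route through time-differentiability of the mild Type-I
ancient solution at `t = −1` (tree `Literature.Analysis.FluidPDE.TypeIAncientMildClassical` / the `…HotSpot.hotSpot_firstOrder` pattern); with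
`deriv`-junk alone the statement would read `0 = N/2`, false — size S/M, not S. -/
def HotTimePin : Prop :=
  ∀ (C : ℝ) (v : ℝ → EuclideanSpace ℝ (Fin 3) → EuclideanSpace ℝ (Fin 3)), Pinned C v →
    ∀ y ∈ hotSet v, deriv (fun s => v s y 2) (-1) = v (-1) 0 2 / 2

/-- **R10 — DISCHARGED BY NAME (v1.4)**: LANDED as p694348 `…LeafUniformPins.hotTimePin` (ns-poloidal-K2-p2 g13; BY-NAME ✓ 04:51Z). -/
theorem stub_hotTimePin : HotTimePin := by
  exact Summit.NavierStokesRegularity.NavierStokesRegularity.Theorems.PoloidalWindowDoorPoloidalWindowRigidityLeafUniformPins.hotTimePin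

/-- **R11 `CurtainInvariant` (PROVABLE, L; LOAD-BEARING for the Morse cell).**  On a hot vortex arc that is MORSE at its base point
(`Δₕv₂(γ 0) ≠ 0`; by R8 and the regularity of the integral curve, `Δₕv₂ ≠ 0` along the whole arc) the curtain quantity
`I₂ = ∂_zz v₂ − |∇ₕ∂_z v₂|²/Δₕv₂` is constant along the arc (`= N″(0)`, the second derivative of the height function of the ridge leaves; proof in
the file header via the ridge surface `S = {∂ₙ̂v₂ = 0}`). -/
def CurtainInvariant : Prop :=
  ∀ (C : ℝ) (v : ℝ → EuclideanSpace ℝ (Fin 3) → EuclideanSpace ℝ (Fin 3)), Pinned C v →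
    (∀ s < 0, ∀ y, ⟪fderiv ℝ (v s) y (Literature.Analysis.FluidPDE.curl (v s) y), EuclideanSpace.single 2 1⟫_ℝ = 0) →
    ∀ (γ : ℝ → EuclideanSpace ℝ (Fin 3)) (ε : ℝ), IsHotArc v γ ε →
      lapH v (γ 0) ≠ 0 →
      ∀ τ ∈ Set.Ioo (-ε) ε, curtain v (γ τ) = curtain v (γ 0)

/-- **R11 — DISCHARGED BY NAME (v1.5)** from the landed
`…Theorems.PoloidalWindowDoorPoloidalWindowRigidityLeafUniformCurtainInvariant.curtainInvariant` (ns-es-p1 g7, `--supports 19708` helper; R11 VERBATIM with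
`Pinned` / `IsHotArc` / `lapH` / `curtain` unfolded), never restated. -/
theorem stub_curtainInvariant : CurtainInvariant := fun C v hP hfr γ ε harc hlap τ hτ =>
  Summit.NavierStokesRegularity.NavierStokesRegularity.Theorems.PoloidalWindowDoorPoloidalWindowRigidityLeafUniformCurtainInvariant.curtainInvariant
    C v hP hfr γ ε harc hlap τ hτ

/-! ## The two research cells of C2a′ (OPEN) — every binder of `stub_cellC2aRidge` verbatim, plus ONE leaf-uniform hypothesis each -/

/-- **Cell FLAT LEAF `CellFlatLeaf` (OPEN, research).**  C2a′ with, in addition, the time pin on the whole hot set (R10) and `Δₕv₂(−1,·) = 0` at every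
point of the hot vortex arc (hence, by R9
at each arc point — NSD horizontal Hessian with zero trace — the whole horizontal Hessian of `v₂(−1,·)` vanishes along the leaf: a hot vortex leaf
flat to second order transversally, everywhere along it).  Contains the translation limits of Morse leaves along which `c₀|ω|² → 0`.  Why it might
fail / why open: flatness along a curve is still consistent with every finite jet (census C1/C2); the cell is the leaf-analogue of thread_axis'
flat-threaded residue S3′; a kill needs the global bound / the ancient history along the whole leaf. -/
def CellFlatLeaf : Prop :=
  ∀ (C : ℝ) (v : ℝ → EuclideanSpace ℝ (Fin 3) → EuclideanSpace ℝ (Fin 3)) (W : Set (ℝ × EuclideanSpace ℝ (Fin 3))),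
    Pinned C v → ThickWindow v W → Peakless v →
    (∀ s < 0, ∀ y, ⟪fderiv ℝ (v s) y (Literature.Analysis.FluidPDE.curl (v s) y), EuclideanSpace.single 2 1⟫_ℝ = 0) →
    IsClosed (hotSet v) → (∀ y ∈ hotSet v, fderiv ℝ (fun x => v (-1) x 2) y = 0) →
    (∀ K O : Set (EuclideanSpace ℝ (Fin 3)), IsCompact K → K.Nonempty → K ⊆ hotSet v → IsOpen O → K ⊆ O →
      O ∩ hotSet v ⊆ K → False) →
    (∀ y ∈ hotSet v, ∀ r : ℝ, 0 < r →
      ∃ y' : EuclideanSpace ℝ (Fin 3), y' 2 = 0 ∧ dist y' y < r ∧ v (-1) y' 2 ≠ v (-1) 0 2) →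
    (∃ (γ : ℝ → EuclideanSpace ℝ (Fin 3)) (ε : ℝ), 0 < ε ∧ γ 0 ∈ hotSet v ∧
      Literature.Analysis.FluidPDE.curl (v (-1)) (γ 0) ≠ 0 ∧
      (∀ τ ∈ Set.Ioo (-ε) ε, HasDerivAt γ (Literature.Analysis.FluidPDE.curl (v (-1)) (γ τ)) τ ∧ γ τ ∈ hotSet v) ∧
      (∀ τ ∈ Set.Ioo (-ε) ε, lapH v (γ τ) = 0)) →
    (∀ y ∈ hotSet v, deriv (fun s => v s y 2) (-1) = v (-1) 0 2 / 2) →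
    False

/-- **Cell MORSE LEAF `CellMorseLeaf` (OPEN, research).**  C2a′ with, in addition, the time pin on the whole hot set (R10), a RIDGE CONSTANT — a real
`c` with `N·c < 0` and `Δₕv₂(−1, γ τ) = c·‖ω(−1, γ τ)‖²` at every point of the arc (transversal curvature `c₀|ω|²`, `c₀ = |c| > 0`, uniform in shape
along the leaf) — and the CURTAIN INVARIANT along the arc (R11); so the ridge surface `S` and the pressure law `−σ∂_z p ≥ |N|/2 + 2|∇ₕ∂_z v₂|` on
the whole leaf are in the closer's hands.
Why it might fail / why open: the invariants are kinematic + pin; the improvement step (recurrence along the leaf renormalised at a point where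
`|ω|²|_Γ` is extremal, or the curtain at large `|z|`) is not carried out; blow-downs at the pin lose the window (CENSUS-C2-g8 B-g8-3). -/
def CellMorseLeaf : Prop :=
  ∀ (C : ℝ) (v : ℝ → EuclideanSpace ℝ (Fin 3) → EuclideanSpace ℝ (Fin 3)) (W : Set (ℝ × EuclideanSpace ℝ (Fin 3))),
    Pinned C v → ThickWindow v W → Peakless v →
    (∀ s < 0, ∀ y, ⟪fderiv ℝ (v s) y (Literature.Analysis.FluidPDE.curl (v s) y), EuclideanSpace.single 2 1⟫_ℝ = 0) →
    IsClosed (hotSet v) → (∀ y ∈ hotSet v, fderiv ℝ (fun x => v (-1) x 2) y = 0) →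
    (∀ K O : Set (EuclideanSpace ℝ (Fin 3)), IsCompact K → K.Nonempty → K ⊆ hotSet v → IsOpen O → K ⊆ O →
      O ∩ hotSet v ⊆ K → False) →
    (∀ y ∈ hotSet v, ∀ r : ℝ, 0 < r →
      ∃ y' : EuclideanSpace ℝ (Fin 3), y' 2 = 0 ∧ dist y' y < r ∧ v (-1) y' 2 ≠ v (-1) 0 2) →
    (∃ (γ : ℝ → EuclideanSpace ℝ (Fin 3)) (ε : ℝ), 0 < ε ∧ γ 0 ∈ hotSet v ∧
      Literature.Analysis.FluidPDE.curl (v (-1)) (γ 0) ≠ 0 ∧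
      (∀ τ ∈ Set.Ioo (-ε) ε, HasDerivAt γ (Literature.Analysis.FluidPDE.curl (v (-1)) (γ τ)) τ ∧ γ τ ∈ hotSet v) ∧
      (∃ c : ℝ, v (-1) 0 2 * c < 0 ∧
        ∀ τ ∈ Set.Ioo (-ε) ε, lapH v (γ τ) = c * ‖Literature.Analysis.FluidPDE.curl (v (-1)) (γ τ)‖ ^ 2) ∧
      (∀ τ ∈ Set.Ioo (-ε) ε, curtain v (γ τ) = curtain v (γ 0))) →
    (∀ y ∈ hotSet v, deriv (fun s => v s y 2) (-1) = v (-1) 0 2 / 2) →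
    False

/-! ## v1.2 — the MORSE leaf's GLOBAL orbit and its two ENDS (STRUCT-g9-1)

The maximal vortex line `Γ` through a Morse hot point is a complete orbit of the bounded `C¹` planar Hamiltonian field `ωₕ(−1,·,0) = −∇^⊥ψ`; the ridge and
curtain laws hold along ALL of it (R16); it is INJECTIVE (a periodic hot Morse orbit would be a compact isolated hot piece, against R3) and has NO regular
limit points (flow box ⇒ return into its own arc), so planar «recurrent ridges» do not exist (census N-g8-2 is empty beyond closed loops) and EACH END either
ESCAPES every compact set or is CAPTURED: it clusters at hot NULL points, which are horizontally FLAT (`Δₕw = c|ω|² → 0` and `w_0z² + w_1z² = (w_zz − I₂)Δₕw → 0`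
along the end) (R17).  The MORSE cell is thereby DERIVED from two finer research cells MORSE-ESCAPING / MORSE-CAPTURED; the captured case is where L18 meets
the flat null points of the C2a′ world.  No mechanism is claimed for either cell; no crux and no summit is proved. -/

/-- Horizontal flatness of the 2-jet of `w = v₂(−1,·)` at `y` (the same predicate as null_leaf's `HFlat`): `∂_a∂_b w(y) = ∂_b∂_a w(y) = 0` for `a` horizontal. -/
def HFlat (v : ℝ → EuclideanSpace ℝ (Fin 3) → EuclideanSpace ℝ (Fin 3)) (y : EuclideanSpace ℝ (Fin 3)) : Prop :=
  ∀ a b : EuclideanSpace ℝ (Fin 3), a 2 = 0 → hess v y a b = 0 ∧ hess v y b a = 0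

/-- **R15 `VortexLineGlobal` (PROVABLE, M; support).**  Through every point there is a GLOBAL integral curve of `ω(−1,·)`: the field is `C¹`
(`slice_facts` / `contDiff_curl`) and BOUNDED on `ℝ³`: the ONE source (v1.3.1, critic's light ask) is the tree's PROVED
`Literature.Analysis.FluidPDE.exists_tube_extension_of_typeI_ancient_mild` (TypeIAncientMildTubeAnalyticity.lean — the slice `v(−1,·)` extends holomorphically to a
UNIFORM complex tube of radius `r > 0` with a UNIFORM bound `B`; its hypotheses are `Pinned`'s first four conjuncts + `C¹` slices from `slice_facts`), whence
`sup‖Dv(−1,·)‖ ≤ B/r` by the Cauchy estimate on each coordinate disc and `sup‖ω(−1,·)‖ < ∞`; so maximal solutions of `γ′ = ω(γ)` (Mathlib Picard–Lindelöf +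
continuation under `‖γ′‖ ≤ sup‖ω‖`) live on all of `ℝ`. -/
def VortexLineGlobal : Prop :=
  ∀ (C : ℝ) (v : ℝ → EuclideanSpace ℝ (Fin 3) → EuclideanSpace ℝ (Fin 3)), Pinned C v →
    ∀ y : EuclideanSpace ℝ (Fin 3), ∃ γ : ℝ → EuclideanSpace ℝ (Fin 3), γ 0 = y ∧ ∀ τ : ℝ, HasDerivAt γ (Literature.Analysis.FluidPDE.curl (v (-1)) (γ τ)) τ

/-- **R15 — DISCHARGED BY NAME (v1.4)**: LANDED as `…LeafUniformVortexLine.vortexLineGlobal` (ns-poloidal-K2-p2 g13, KEY-NS #189/#190). -/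
theorem stub_vortexLineGlobal : VortexLineGlobal := by
  exact Summit.NavierStokesRegularity.NavierStokesRegularity.Theorems.PoloidalWindowDoorPoloidalWindowRigidityLeafUniformVortexLine.vortexLineGlobal

/-- **R16 `LeafGlobalLaw` (PROVABLE, L; support — the GLOBAL form of R2 + R8 (+ R11 on Morse leaves) along a complete vortex line; v1.3: the Morse
hypothesis now guards only the curtain law).**  Along a global integral curve `γ` of `ω(−1,·)` starting at a hot point with `ω ≠ 0`: (a) every `γ τ` is hot
(first integrals `(γ τ)₂` and `w(γ τ)`: poloidality + frozen law, tree `…LoopTangencyPin.apply_integralCurve_eq`), `ω(γ τ) ≠ 0` (ODE uniqueness: an integral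
curve through a non-zero of a `C¹` field never meets a zero) and the ridge law `Δₕw(γ τ)‖ω(γ 0)‖² = Δₕw(γ 0)‖ω(γ τ)‖²` (R8's pointwise Wronskian identity at
every `τ`, constancy on the connected line); (b) if moreover `Δₕw(γ 0) ≠ 0` (MORSE; then `Δₕw ≠ 0` along `γ` by (a)), the curtain law `curtain(γ τ) = curtain(γ 0)`
(R11's identity).  The calculus is R8/R11's — one hand proves the pointwise identities once and gets R8, R11 and R16 together. -/
def LeafGlobalLaw : Prop :=
  ∀ (C : ℝ) (v : ℝ → EuclideanSpace ℝ (Fin 3) → EuclideanSpace ℝ (Fin 3)), Pinned C v →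
    (∀ s < 0, ∀ y, ⟪fderiv ℝ (v s) y (Literature.Analysis.FluidPDE.curl (v s) y), EuclideanSpace.single 2 1⟫_ℝ = 0) →
    (∀ y ∈ hotSet v, fderiv ℝ (fun x => v (-1) x 2) y = 0) →
    ∀ γ : ℝ → EuclideanSpace ℝ (Fin 3), (∀ τ : ℝ, HasDerivAt γ (Literature.Analysis.FluidPDE.curl (v (-1)) (γ τ)) τ) → γ 0 ∈ hotSet v →
      Literature.Analysis.FluidPDE.curl (v (-1)) (γ 0) ≠ 0 →
      (∀ τ : ℝ, γ τ ∈ hotSet v ∧ Literature.Analysis.FluidPDE.curl (v (-1)) (γ τ) ≠ 0 ∧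
        lapH v (γ τ) * ‖Literature.Analysis.FluidPDE.curl (v (-1)) (γ 0)‖ ^ 2 = lapH v (γ 0) * ‖Literature.Analysis.FluidPDE.curl (v (-1)) (γ τ)‖ ^ 2) ∧
      (lapH v (γ 0) ≠ 0 → ∀ τ : ℝ, curtain v (γ τ) = curtain v (γ 0))

/-- **R16 — DISCHARGED BY NAME (v1.4)**: LANDED as `…LeafUniformCurtainCore` + `…LeafUniformLeafGlobalLaw.leafGlobalLaw` (ns-es-p1 g7, `--supports 19708` helper; R16 VERBATIM with the line's defs unfolded); es-p1's wiring, never restated. -/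
theorem stub_leafGlobalLaw : LeafGlobalLaw := fun C v hP hfr hcrit γ hγ h0 hne =>
  Summit.NavierStokesRegularity.NavierStokesRegularity.Theorems.PoloidalWindowDoorPoloidalWindowRigidityLeafUniformLeafGlobalLaw.leafGlobalLaw C v hP hfr hcrit γ hγ h0 hne

/-- **R18 `HotRegularAlone` (PROVABLE, L; support — near a REGULAR hot point the hot set is ONE vortex arc; STRUCT-g9-2 (W1)).**  The slice `v(−1,·)` is
real-analytic on `ℝ³` (tree, PROVED: `IsTypeIAncientMild.analyticOnNhd_slice_univ` ∘ `…PoloidalWindowDoorPoloidalWindowRigidityWindow.isTypeIAncientMild_of_class`);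
near a hot `y` with `ω(y) ≠ 0`, in the plane `P₀` the frozen law makes `w := v₂(−1,·)` a function of the local stream value, `w = Φ ∘ ψ` with `∇ψ = (ω₁, −ω₀) ≠ 0`
(flow box; analytic implicit chart, tree `Literature.Analysis.Calculus.ImplicitChart` `analyticAt_implicitFunction`), `Φ` analytic in one variable with a local
maximum `N` at `ψ₀`; `Φ ≢ N` near `ψ₀` (else a plane-neighbourhood of `y` is hot, contradicting the no-interior hypothesis R4), so by the one-variable identity
theorem (Mathlib `AnalyticAt.eventually_eq_or_eventually_ne`) `ψ₀` is isolated in `{Φ = N}`: `Φ = N − a(ψ−ψ₀)^{2k}(1+…)`, `a ≠ 0`, `k ≥ 1` — the pair `(k, a)` is a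
LEAF INVARIANT extending R8 (`k = 1 ⇔` MORSE with `c = Φ''(ψ₀)`; FLAT `⇔ k ≥ 2`) — and the hot set near `y` is exactly the arc `{ψ = ψ₀}` = the vortex arc through
`y`.  Holds for MORSE and FLAT leaves alike; it is the only place analyticity enters this line. -/
def HotRegularAlone : Prop :=
  ∀ (C : ℝ) (v : ℝ → EuclideanSpace ℝ (Fin 3) → EuclideanSpace ℝ (Fin 3)), Pinned C v →
    (∀ s < 0, ∀ y, ⟪fderiv ℝ (v s) y (Literature.Analysis.FluidPDE.curl (v s) y), EuclideanSpace.single 2 1⟫_ℝ = 0) →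
    (∀ y ∈ hotSet v, ∀ r : ℝ, 0 < r →
      ∃ y' : EuclideanSpace ℝ (Fin 3), y' 2 = 0 ∧ dist y' y < r ∧ v (-1) y' 2 ≠ v (-1) 0 2) →
    (∀ y ∈ hotSet v, Literature.Analysis.FluidPDE.curl (v (-1)) y ≠ 0 → ∃ r : ℝ, 0 < r ∧ ∃ (α : ℝ → EuclideanSpace ℝ (Fin 3)) (δ : ℝ), 0 < δ ∧ α 0 = y ∧
        (∀ s ∈ Set.Ioo (-δ) δ, HasDerivAt α (Literature.Analysis.FluidPDE.curl (v (-1)) (α s)) s) ∧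
        ∀ y' ∈ hotSet v, dist y' y < r → ∃ s ∈ Set.Ioo (-δ) δ, y' = α s)

/-- **R18 — DISCHARGED BY NAME** from the landed `…Theorems.PoloidalWindowDoorPoloidalWindowRigidityLeafUniformHotRegularAlone.hotRegularAlone`
(p701832 `…LeafUniformAloneCore` + p701918, ns-es-p1 g7, `--supports 19708` helper; R18 VERBATIM with `Pinned` / `hotSet` unfolded), never restated. -/
theorem stub_hotRegularAlone : HotRegularAlone := fun C v hP hfr hni y hy hω =>
  Summit.NavierStokesRegularity.NavierStokesRegularity.Theorems.PoloidalWindowDoorPoloidalWindowRigidityLeafUniformHotRegularAlone.hotRegularAlone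
    C v hP hfr hni y hy hω

/-- **R19 `LeafEnds` (PROVABLE, M/L; support — topological dynamics of a complete hot leaf, MORSE OR FLAT; v1.3 replaces v1.2's Morse-only R17).**  Given
(a) of R16 along a complete vortex line `γ`, local aloneness of regular hot points (R18's conclusion), a closed hot set and no compact isolated hot piece (R3):
(i) `γ` is INJECTIVE — a non-injective solution of the autonomous `C¹` ODE is periodic, its image is compact and, by aloneness at each of its points, relatively
open in `H`: a compact isolated hot piece; (ii) for each end (`atTop`, `atBot`) either `γ` leaves every compact set or it has a cluster point `q`; then `q ∈ H`
(closed), `ω(q) = 0` (were `ω(q) ≠ 0`, aloneness at `q` puts the returning points `γ τ_k` on the single arc through `q`, and ODE uniqueness + injectivity force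
`τ_k → τ*` with `γ τ* = q`, against `τ_k → ∞`), and `Δₕw(q) = 0` (the ridge law gives `Δₕw(γ τ_k) = Δₕw(γ 0)‖ω(γ τ_k)‖²/‖ω(γ 0)‖² → 0` by continuity of `ω`
and of `Δₕw` for the `C²` slice).  (Under the analytic web — Łojasiewicz's planar structure theorem, not used here — the captured end even CONVERGES to `q`
along an analytic arc of finite length; not claimed.)  PLANARITY (v1.3.1, answers critic P1 on v1.2's R17): the hot set is PLANAR BY DEFINITION
(`hotSet v ⊆ P₀ = {y₂ = 0}`) and R3 / aloneness / isolation are statements about that planar set, so the only normal direction is the horizontal `n` and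
`∂ₙ∂ₙw = Δₕw` (Morse) resp. the finite transversal order `2k` (R18) decide aloneness INSIDE `P₀`; a hot 2-sheet of `ℝ³` through the leaf with tangent
`αn + βe_z`, `β ≠ 0` (2-jet-consistent when `Δₕw·curtain = 0`) meets `P₀` transversally in the leaf itself and does not affect R3 — no Morse–Bott analysis on
`span(n, e_z)` and no `curtain ≠ 0` hypothesis is needed. -/
def LeafEnds : Prop :=
  ∀ (C : ℝ) (v : ℝ → EuclideanSpace ℝ (Fin 3) → EuclideanSpace ℝ (Fin 3)), Pinned C v → IsClosed (hotSet v) →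
    (∀ K O : Set (EuclideanSpace ℝ (Fin 3)), IsCompact K → K.Nonempty → K ⊆ hotSet v → IsOpen O → K ⊆ O →
      O ∩ hotSet v ⊆ K → False) →
    (∀ y ∈ hotSet v, Literature.Analysis.FluidPDE.curl (v (-1)) y ≠ 0 → ∃ r : ℝ, 0 < r ∧ ∃ (α : ℝ → EuclideanSpace ℝ (Fin 3)) (δ : ℝ), 0 < δ ∧ α 0 = y ∧
        (∀ s ∈ Set.Ioo (-δ) δ, HasDerivAt α (Literature.Analysis.FluidPDE.curl (v (-1)) (α s)) s) ∧
        ∀ y' ∈ hotSet v, dist y' y < r → ∃ s ∈ Set.Ioo (-δ) δ, y' = α s) →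
    ∀ γ : ℝ → EuclideanSpace ℝ (Fin 3), (∀ τ : ℝ, HasDerivAt γ (Literature.Analysis.FluidPDE.curl (v (-1)) (γ τ)) τ) →
      (∀ τ : ℝ, γ τ ∈ hotSet v ∧ Literature.Analysis.FluidPDE.curl (v (-1)) (γ τ) ≠ 0 ∧
        lapH v (γ τ) * ‖Literature.Analysis.FluidPDE.curl (v (-1)) (γ 0)‖ ^ 2 = lapH v (γ 0) * ‖Literature.Analysis.FluidPDE.curl (v (-1)) (γ τ)‖ ^ 2) →
      Function.Injective γ ∧
      (Filter.Tendsto γ Filter.atTop (Filter.cocompact (EuclideanSpace ℝ (Fin 3))) ∨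
        ∃ q : EuclideanSpace ℝ (Fin 3), MapClusterPt q Filter.atTop γ ∧ q ∈ hotSet v ∧ Literature.Analysis.FluidPDE.curl (v (-1)) q = 0 ∧ lapH v q = 0) ∧
      (Filter.Tendsto γ Filter.atBot (Filter.cocompact (EuclideanSpace ℝ (Fin 3))) ∨
        ∃ q : EuclideanSpace ℝ (Fin 3), MapClusterPt q Filter.atBot γ ∧ q ∈ hotSet v ∧ Literature.Analysis.FluidPDE.curl (v (-1)) q = 0 ∧ lapH v q = 0)

/-- **R19 — DISCHARGED BY NAME (v1.4)**: LANDED as p698325 `…LeafUniformLeafEnds.leafEnds` (ns-poloidal-K2-p2 g13). -/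
theorem stub_leafEnds : LeafEnds := by
  exact Summit.NavierStokesRegularity.NavierStokesRegularity.Theorems.PoloidalWindowDoorPoloidalWindowRigidityLeafUniformLeafEnds.leafEnds

/-- **R20 `HotFlatPointHFlat` (PROVABLE, S/M; support).**  A hot point with `Δₕw = 0` is horizontally FLAT: `y` is a global extremum of `w = v₂(−1,·)` on `ℝ³`
(the pinned bound at `t = −1`), so `σ·Hess w(y) ≤ 0` (`σ = sign N`; `C²` slice, symmetric nested `fderiv`s — Mathlib `second_derivative_symmetric`); a negative
semidefinite horizontal block with zero trace vanishes, and the `2×2` minors on `(a, e₂)` then kill the mixed entries `∂_a∂_z w`.  In particular EVERY point of a flat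
leaf, and every captured end point (R19: `Δₕw(q) = 0`), is `HFlat`. -/
def HotFlatPointHFlat : Prop :=
  ∀ (C : ℝ) (v : ℝ → EuclideanSpace ℝ (Fin 3) → EuclideanSpace ℝ (Fin 3)), Pinned C v → ∀ y ∈ hotSet v, lapH v y = 0 → HFlat v y

/-- **R20 — DISCHARGED BY NAME (v1.4)**: LANDED as p697413 `…LeafUniformHFlat.hotFlatPointHFlat` (ns-poloidal-K2-p2 g13; BY-NAME ✓ 05:13Z). -/
theorem stub_hotFlatPointHFlat : HotFlatPointHFlat := by
  exact Summit.NavierStokesRegularity.NavierStokesRegularity.Theorems.PoloidalWindowDoorPoloidalWindowRigidityLeafUniformHFlat.hotFlatPointHFlat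

/-- **Cell MORSE-ESCAPING (OPEN, research).**  EVERY binder of `CellMorseLeaf` (hence of C2a′) + the complete Morse leaf `γ` through the arc's base point
with the global ridge/curtain laws, injective, BOTH ends leaving every compact set of `ℝ³` ⇒ `False`.  Why it might fail: this is the generic picture (a
proper unbounded hot vortex line carrying `w = N` and `−σ∂_z p ≥ |N|/2 + |c||ω|²`); the missing input is a Liouville / zero-mode mechanism AT INFINITY along a
curve (codimension 2 for box means, B-g8-4). -/
def CellMorseEscaping : Prop :=
  ∀ (C : ℝ) (v : ℝ → EuclideanSpace ℝ (Fin 3) → EuclideanSpace ℝ (Fin 3)) (W : Set (ℝ × EuclideanSpace ℝ (Fin 3))),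
    Pinned C v → ThickWindow v W → Peakless v →
    (∀ s < 0, ∀ y, ⟪fderiv ℝ (v s) y (Literature.Analysis.FluidPDE.curl (v s) y), EuclideanSpace.single 2 1⟫_ℝ = 0) →
    IsClosed (hotSet v) → (∀ y ∈ hotSet v, fderiv ℝ (fun x => v (-1) x 2) y = 0) →
    (∀ K O : Set (EuclideanSpace ℝ (Fin 3)), IsCompact K → K.Nonempty → K ⊆ hotSet v → IsOpen O → K ⊆ O →
      O ∩ hotSet v ⊆ K → False) →
    (∀ y ∈ hotSet v, ∀ r : ℝ, 0 < r →
      ∃ y' : EuclideanSpace ℝ (Fin 3), y' 2 = 0 ∧ dist y' y < r ∧ v (-1) y' 2 ≠ v (-1) 0 2) →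
    (∃ (γ : ℝ → EuclideanSpace ℝ (Fin 3)) (ε : ℝ), 0 < ε ∧ γ 0 ∈ hotSet v ∧
      Literature.Analysis.FluidPDE.curl (v (-1)) (γ 0) ≠ 0 ∧
      (∀ τ ∈ Set.Ioo (-ε) ε, HasDerivAt γ (Literature.Analysis.FluidPDE.curl (v (-1)) (γ τ)) τ ∧ γ τ ∈ hotSet v) ∧
      (∃ c : ℝ, v (-1) 0 2 * c < 0 ∧
        ∀ τ ∈ Set.Ioo (-ε) ε, lapH v (γ τ) = c * ‖Literature.Analysis.FluidPDE.curl (v (-1)) (γ τ)‖ ^ 2) ∧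
      (∀ τ ∈ Set.Ioo (-ε) ε, curtain v (γ τ) = curtain v (γ 0))) →
    (∀ y ∈ hotSet v, deriv (fun s => v s y 2) (-1) = v (-1) 0 2 / 2) →
    (∃ γ : ℝ → EuclideanSpace ℝ (Fin 3), γ 0 ∈ hotSet v ∧ Literature.Analysis.FluidPDE.curl (v (-1)) (γ 0) ≠ 0 ∧ lapH v (γ 0) ≠ 0 ∧
      (∀ τ : ℝ, HasDerivAt γ (Literature.Analysis.FluidPDE.curl (v (-1)) (γ τ)) τ) ∧
      (∀ τ : ℝ, γ τ ∈ hotSet v ∧ Literature.Analysis.FluidPDE.curl (v (-1)) (γ τ) ≠ 0 ∧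
        lapH v (γ τ) * ‖Literature.Analysis.FluidPDE.curl (v (-1)) (γ 0)‖ ^ 2 = lapH v (γ 0) * ‖Literature.Analysis.FluidPDE.curl (v (-1)) (γ τ)‖ ^ 2 ∧
        curtain v (γ τ) = curtain v (γ 0)) ∧
      Function.Injective γ ∧
      Filter.Tendsto γ Filter.atTop (Filter.cocompact (EuclideanSpace ℝ (Fin 3))) ∧
      Filter.Tendsto γ Filter.atBot (Filter.cocompact (EuclideanSpace ℝ (Fin 3)))) →
    False

/-- **stub MORSE-ESCAPING** (OPEN, research). -/
theorem stub_cellMorseEscaping : CellMorseEscaping := by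
  sorry

/-- **Cell MORSE-CAPTURED (OPEN, research).**  EVERY binder of `CellMorseLeaf` + the complete Morse leaf `γ` (global laws, injective) having an END that
clusters at a hot NULL point `q` which is horizontally FLAT (`HFlat v q`) ⇒ `False`.  Why it might fail: a Morse leaf limiting onto a flat null continuum
is consistent with every finite jet; the missing input is the structure of the hot set near flat null points approached by Morse leaves (null_leaf's
NULL-FLAT / LAYER analysis assumes `ω ≡ 0` on `H` and does not apply verbatim). -/
def CellMorseCaptured : Prop :=
  ∀ (C : ℝ) (v : ℝ → EuclideanSpace ℝ (Fin 3) → EuclideanSpace ℝ (Fin 3)) (W : Set (ℝ × EuclideanSpace ℝ (Fin 3))),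
    Pinned C v → ThickWindow v W → Peakless v →
    (∀ s < 0, ∀ y, ⟪fderiv ℝ (v s) y (Literature.Analysis.FluidPDE.curl (v s) y), EuclideanSpace.single 2 1⟫_ℝ = 0) →
    IsClosed (hotSet v) → (∀ y ∈ hotSet v, fderiv ℝ (fun x => v (-1) x 2) y = 0) →
    (∀ K O : Set (EuclideanSpace ℝ (Fin 3)), IsCompact K → K.Nonempty → K ⊆ hotSet v → IsOpen O → K ⊆ O →
      O ∩ hotSet v ⊆ K → False) →
    (∀ y ∈ hotSet v, ∀ r : ℝ, 0 < r →
      ∃ y' : EuclideanSpace ℝ (Fin 3), y' 2 = 0 ∧ dist y' y < r ∧ v (-1) y' 2 ≠ v (-1) 0 2) →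
    (∃ (γ : ℝ → EuclideanSpace ℝ (Fin 3)) (ε : ℝ), 0 < ε ∧ γ 0 ∈ hotSet v ∧
      Literature.Analysis.FluidPDE.curl (v (-1)) (γ 0) ≠ 0 ∧
      (∀ τ ∈ Set.Ioo (-ε) ε, HasDerivAt γ (Literature.Analysis.FluidPDE.curl (v (-1)) (γ τ)) τ ∧ γ τ ∈ hotSet v) ∧
      (∃ c : ℝ, v (-1) 0 2 * c < 0 ∧
        ∀ τ ∈ Set.Ioo (-ε) ε, lapH v (γ τ) = c * ‖Literature.Analysis.FluidPDE.curl (v (-1)) (γ τ)‖ ^ 2) ∧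
      (∀ τ ∈ Set.Ioo (-ε) ε, curtain v (γ τ) = curtain v (γ 0))) →
    (∀ y ∈ hotSet v, deriv (fun s => v s y 2) (-1) = v (-1) 0 2 / 2) →
    (∃ γ : ℝ → EuclideanSpace ℝ (Fin 3), γ 0 ∈ hotSet v ∧ Literature.Analysis.FluidPDE.curl (v (-1)) (γ 0) ≠ 0 ∧ lapH v (γ 0) ≠ 0 ∧
      (∀ τ : ℝ, HasDerivAt γ (Literature.Analysis.FluidPDE.curl (v (-1)) (γ τ)) τ) ∧
      (∀ τ : ℝ, γ τ ∈ hotSet v ∧ Literature.Analysis.FluidPDE.curl (v (-1)) (γ τ) ≠ 0 ∧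
        lapH v (γ τ) * ‖Literature.Analysis.FluidPDE.curl (v (-1)) (γ 0)‖ ^ 2 = lapH v (γ 0) * ‖Literature.Analysis.FluidPDE.curl (v (-1)) (γ τ)‖ ^ 2 ∧
        curtain v (γ τ) = curtain v (γ 0)) ∧
      Function.Injective γ ∧
      ∃ q : EuclideanSpace ℝ (Fin 3), (MapClusterPt q Filter.atTop γ ∨ MapClusterPt q Filter.atBot γ) ∧
        q ∈ hotSet v ∧ Literature.Analysis.FluidPDE.curl (v (-1)) q = 0 ∧ HFlat v q) →
    False

/-- **stub MORSE-CAPTURED** (OPEN, research). -/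
theorem stub_cellMorseCaptured : CellMorseCaptured := by
  sorry

/-- **KERNEL v1.3: MORSE ⇐ R15 ∧ R16 ∧ R18 ∧ R19 ∧ R20 ∧ MORSE-ESCAPING ∧ MORSE-CAPTURED** (sorry-free): extend the arc's base point to a complete vortex
line (R15), transport the laws (R16; `Δₕw(γ 0) = c‖ω(γ 0)‖² ≠ 0` from the Morse datum at `τ = 0` unlocks the curtain law), read off injectivity and the two end
alternatives (R19, with R18's aloneness), flatten the captured end point (R20), and dispatch: both ends escaping ⇒ MORSE-ESCAPING, otherwise ⇒ MORSE-CAPTURED. -/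
theorem cellMorseLeaf_of_ends (hR15 : VortexLineGlobal) (hR16 : LeafGlobalLaw) (hR18 : HotRegularAlone) (hR19 : LeafEnds)
    (hR20 : HotFlatPointHFlat) (hEsc : CellMorseEscaping) (hCap : CellMorseCaptured) : CellMorseLeaf := by
  intro C v W hP hT hK hFL hcl hcrit hR3 hR4 hM hpin
  obtain ⟨γ₀, ε, hε, hγ0, hω0, hγ, ⟨c, hc, hlaw⟩, hcurt⟩ := hM
  have h0mem : (0 : ℝ) ∈ Set.Ioo (-ε) ε := ⟨by linarith, hε⟩
  have hlap0 : lapH v (γ₀ 0) ≠ 0 := by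
    rw [hlaw 0 h0mem]
    have hc0 : c ≠ 0 := by
      rintro rfl
      simp at hc
    have hn : ‖Literature.Analysis.FluidPDE.curl (v (-1)) (γ₀ 0)‖ ^ 2 ≠ 0 := by
      have : ‖Literature.Analysis.FluidPDE.curl (v (-1)) (γ₀ 0)‖ ≠ 0 := norm_ne_zero_iff.mpr hω0
      positivity
    exact mul_ne_zero hc0 hn
  obtain ⟨γ, hγ0', hγ'⟩ := hR15 C v hP (γ₀ 0)
  have hγ0mem : γ 0 ∈ hotSet v := by rw [hγ0']; exact hγ0
  have hω0' : Literature.Analysis.FluidPDE.curl (v (-1)) (γ 0) ≠ 0 := by rw [hγ0']; exact hω0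
  have hlap0' : lapH v (γ 0) ≠ 0 := by rw [hγ0']; exact hlap0
  obtain ⟨hridge, hcurt'⟩ := hR16 C v hP hFL hcrit γ hγ' hγ0mem hω0'
  have hlaws : ∀ τ : ℝ, γ τ ∈ hotSet v ∧ Literature.Analysis.FluidPDE.curl (v (-1)) (γ τ) ≠ 0 ∧
      lapH v (γ τ) * ‖Literature.Analysis.FluidPDE.curl (v (-1)) (γ 0)‖ ^ 2 = lapH v (γ 0) * ‖Literature.Analysis.FluidPDE.curl (v (-1)) (γ τ)‖ ^ 2 ∧
      curtain v (γ τ) = curtain v (γ 0) := fun τ =>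
    ⟨(hridge τ).1, (hridge τ).2.1, (hridge τ).2.2, hcurt' hlap0' τ⟩
  have halone := hR18 C v hP hFL hR4
  obtain ⟨hinj, htop, hbot⟩ := hR19 C v hP hcl hR3 halone γ hγ' hridge
  rcases htop with htop | ⟨q, hq, hqH, hqω, hqL⟩
  · rcases hbot with hbot | ⟨q, hq, hqH, hqω, hqL⟩
    · exact hEsc C v W hP hT hK hFL hcl hcrit hR3 hR4 ⟨γ₀, ε, hε, hγ0, hω0, hγ, ⟨c, hc, hlaw⟩, hcurt⟩ hpin
        ⟨γ, hγ0mem, hω0', hlap0', hγ', hlaws, hinj, htop, hbot⟩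
    · exact hCap C v W hP hT hK hFL hcl hcrit hR3 hR4 ⟨γ₀, ε, hε, hγ0, hω0, hγ, ⟨c, hc, hlaw⟩, hcurt⟩ hpin
        ⟨γ, hγ0mem, hω0', hlap0', hγ', hlaws, hinj, q, Or.inr hq, hqH, hqω, hR20 C v hP q hqH hqL⟩
  · exact hCap C v W hP hT hK hFL hcl hcrit hR3 hR4 ⟨γ₀, ε, hε, hγ0, hω0, hγ, ⟨c, hc, hlaw⟩, hcurt⟩ hpin
      ⟨γ, hγ0mem, hω0', hlap0', hγ', hlaws, hinj, q, Or.inl hq, hqH, hqω, hR20 C v hP q hqH hqL⟩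

/-- **MORSE LEAF (DERIVED since v1.2)** ⇐ R15 ∧ R16 ∧ R18 ∧ R19 ∧ R20 ∧ MORSE-ESCAPING ∧ MORSE-CAPTURED (name kept for the kernel below). -/
theorem stub_cellMorseLeaf : CellMorseLeaf :=
  cellMorseLeaf_of_ends stub_vortexLineGlobal stub_leafGlobalLaw stub_hotRegularAlone stub_leafEnds stub_hotFlatPointHFlat
    stub_cellMorseEscaping stub_cellMorseCaptured

/-! ## v1.3 — the FLAT leaf gets the same global normal form (STRUCT-g9-2 (W1)): complete, injective, HFlat at every point, ends ESCAPE or are CAPTURED -/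

/-- **Cell FLAT-ESCAPING (OPEN, research).**  EVERY binder of `CellFlatLeaf` (hence of C2a′) VERBATIM + the complete flat leaf `γ` through the arc's base point:
hot, `ω ≠ 0`, `Δₕw = 0` and `HFlat` at every point, injective, BOTH ends leaving every compact set ⇒ `False`.  Why it might fail: a proper unbounded flat hot
vortex line (`w = N` to even order `2k ≥ 4` transversally, `−σ∂_z p ≥ |N|/2` along it) is consistent with every finite jet and with the local NS identities; the
missing input is a mechanism at infinity along a curve (B-g8-4). -/
def CellFlatEscaping : Prop :=
  ∀ (C : ℝ) (v : ℝ → EuclideanSpace ℝ (Fin 3) → EuclideanSpace ℝ (Fin 3)) (W : Set (ℝ × EuclideanSpace ℝ (Fin 3))),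
    Pinned C v → ThickWindow v W → Peakless v →
    (∀ s < 0, ∀ y, ⟪fderiv ℝ (v s) y (Literature.Analysis.FluidPDE.curl (v s) y), EuclideanSpace.single 2 1⟫_ℝ = 0) →
    IsClosed (hotSet v) → (∀ y ∈ hotSet v, fderiv ℝ (fun x => v (-1) x 2) y = 0) →
    (∀ K O : Set (EuclideanSpace ℝ (Fin 3)), IsCompact K → K.Nonempty → K ⊆ hotSet v → IsOpen O → K ⊆ O →
      O ∩ hotSet v ⊆ K → False) →
    (∀ y ∈ hotSet v, ∀ r : ℝ, 0 < r →
      ∃ y' : EuclideanSpace ℝ (Fin 3), y' 2 = 0 ∧ dist y' y < r ∧ v (-1) y' 2 ≠ v (-1) 0 2) →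
    (∃ (γ : ℝ → EuclideanSpace ℝ (Fin 3)) (ε : ℝ), 0 < ε ∧ γ 0 ∈ hotSet v ∧
      Literature.Analysis.FluidPDE.curl (v (-1)) (γ 0) ≠ 0 ∧
      (∀ τ ∈ Set.Ioo (-ε) ε, HasDerivAt γ (Literature.Analysis.FluidPDE.curl (v (-1)) (γ τ)) τ ∧ γ τ ∈ hotSet v) ∧
      (∀ τ ∈ Set.Ioo (-ε) ε, lapH v (γ τ) = 0)) →
    (∀ y ∈ hotSet v, deriv (fun s => v s y 2) (-1) = v (-1) 0 2 / 2) →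
    (∃ γ : ℝ → EuclideanSpace ℝ (Fin 3), γ 0 ∈ hotSet v ∧ Literature.Analysis.FluidPDE.curl (v (-1)) (γ 0) ≠ 0 ∧
      (∀ τ : ℝ, HasDerivAt γ (Literature.Analysis.FluidPDE.curl (v (-1)) (γ τ)) τ) ∧
      (∀ τ : ℝ, γ τ ∈ hotSet v ∧ Literature.Analysis.FluidPDE.curl (v (-1)) (γ τ) ≠ 0 ∧ lapH v (γ τ) = 0 ∧ HFlat v (γ τ)) ∧
      Function.Injective γ ∧
      Filter.Tendsto γ Filter.atTop (Filter.cocompact (EuclideanSpace ℝ (Fin 3))) ∧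
      Filter.Tendsto γ Filter.atBot (Filter.cocompact (EuclideanSpace ℝ (Fin 3)))) →
    False

/-- **stub FLAT-ESCAPING** (OPEN, research). -/
theorem stub_cellFlatEscaping : CellFlatEscaping := by
  sorry

/-- **Cell FLAT-CAPTURED (OPEN, research).**  EVERY binder of `CellFlatLeaf` VERBATIM + the complete flat leaf `γ` (as above) having an END that clusters at a
hot NULL point `q`, itself `HFlat` ⇒ `False`.  Why it might fail: this is null_leaf's NULL-FLAT world approached along a flat leaf — consistent with every finite
jet; the missing input is the structure of `H` at flat null points (STRUCT-g9-2 (W2): every regular level half-branch of `ψ` at `q` is hot; hot extrema of `ψ` are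
impossible) plus a mechanism. -/
def CellFlatCaptured : Prop :=
  ∀ (C : ℝ) (v : ℝ → EuclideanSpace ℝ (Fin 3) → EuclideanSpace ℝ (Fin 3)) (W : Set (ℝ × EuclideanSpace ℝ (Fin 3))),
    Pinned C v → ThickWindow v W → Peakless v →
    (∀ s < 0, ∀ y, ⟪fderiv ℝ (v s) y (Literature.Analysis.FluidPDE.curl (v s) y), EuclideanSpace.single 2 1⟫_ℝ = 0) →
    IsClosed (hotSet v) → (∀ y ∈ hotSet v, fderiv ℝ (fun x => v (-1) x 2) y = 0) →
    (∀ K O : Set (EuclideanSpace ℝ (Fin 3)), IsCompact K → K.Nonempty → K ⊆ hotSet v → IsOpen O → K ⊆ O →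
      O ∩ hotSet v ⊆ K → False) →
    (∀ y ∈ hotSet v, ∀ r : ℝ, 0 < r →
      ∃ y' : EuclideanSpace ℝ (Fin 3), y' 2 = 0 ∧ dist y' y < r ∧ v (-1) y' 2 ≠ v (-1) 0 2) →
    (∃ (γ : ℝ → EuclideanSpace ℝ (Fin 3)) (ε : ℝ), 0 < ε ∧ γ 0 ∈ hotSet v ∧
      Literature.Analysis.FluidPDE.curl (v (-1)) (γ 0) ≠ 0 ∧
      (∀ τ ∈ Set.Ioo (-ε) ε, HasDerivAt γ (Literature.Analysis.FluidPDE.curl (v (-1)) (γ τ)) τ ∧ γ τ ∈ hotSet v) ∧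
      (∀ τ ∈ Set.Ioo (-ε) ε, lapH v (γ τ) = 0)) →
    (∀ y ∈ hotSet v, deriv (fun s => v s y 2) (-1) = v (-1) 0 2 / 2) →
    (∃ γ : ℝ → EuclideanSpace ℝ (Fin 3), γ 0 ∈ hotSet v ∧ Literature.Analysis.FluidPDE.curl (v (-1)) (γ 0) ≠ 0 ∧
      (∀ τ : ℝ, HasDerivAt γ (Literature.Analysis.FluidPDE.curl (v (-1)) (γ τ)) τ) ∧
      (∀ τ : ℝ, γ τ ∈ hotSet v ∧ Literature.Analysis.FluidPDE.curl (v (-1)) (γ τ) ≠ 0 ∧ lapH v (γ τ) = 0 ∧ HFlat v (γ τ)) ∧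
      Function.Injective γ ∧
      ∃ q : EuclideanSpace ℝ (Fin 3), (MapClusterPt q Filter.atTop γ ∨ MapClusterPt q Filter.atBot γ) ∧
        q ∈ hotSet v ∧ Literature.Analysis.FluidPDE.curl (v (-1)) q = 0 ∧ HFlat v q) →
    False

/-- **stub FLAT-CAPTURED** (OPEN, research). -/
theorem stub_cellFlatCaptured : CellFlatCaptured := by
  sorry

/-- **KERNEL v1.3: FLAT ⇐ R15 ∧ R16 ∧ R18 ∧ R19 ∧ R20 ∧ FLAT-ESCAPING ∧ FLAT-CAPTURED** (sorry-free): complete vortex line through the base point (R15); hot,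
non-vanishing and — by the ridge law with `Δₕw(γ 0) = 0` — FLAT along all of it (R16 (a)), hence `HFlat` everywhere on it (R20); injectivity and the end
alternatives (R19 with R18); the captured end point is `HFlat` (R20); dispatch. -/
theorem cellFlatLeaf_of_ends (hR15 : VortexLineGlobal) (hR16 : LeafGlobalLaw) (hR18 : HotRegularAlone) (hR19 : LeafEnds)
    (hR20 : HotFlatPointHFlat) (hEsc : CellFlatEscaping) (hCap : CellFlatCaptured) : CellFlatLeaf := by
  intro C v W hP hT hK hFL hcl hcrit hR3 hR4 hF hpin
  obtain ⟨γ₀, ε, hε, hγ0, hω0, hγ, hflat⟩ := hF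
  have h0mem : (0 : ℝ) ∈ Set.Ioo (-ε) ε := ⟨by linarith, hε⟩
  have hlap0 : lapH v (γ₀ 0) = 0 := hflat 0 h0mem
  obtain ⟨γ, hγ0', hγ'⟩ := hR15 C v hP (γ₀ 0)
  have hγ0mem : γ 0 ∈ hotSet v := by rw [hγ0']; exact hγ0
  have hω0' : Literature.Analysis.FluidPDE.curl (v (-1)) (γ 0) ≠ 0 := by rw [hγ0']; exact hω0
  have hlap0' : lapH v (γ 0) = 0 := by rw [hγ0']; exact hlap0
  obtain ⟨hridge, -⟩ := hR16 C v hP hFL hcrit γ hγ' hγ0mem hω0'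
  have hn0 : ‖Literature.Analysis.FluidPDE.curl (v (-1)) (γ 0)‖ ^ 2 ≠ 0 := by
    have : ‖Literature.Analysis.FluidPDE.curl (v (-1)) (γ 0)‖ ≠ 0 := norm_ne_zero_iff.mpr hω0'
    positivity
  have hflatall : ∀ τ : ℝ, lapH v (γ τ) = 0 := fun τ => by
    have h := (hridge τ).2.2
    rw [hlap0', zero_mul] at h
    rcases mul_eq_zero.mp h with h' | h'
    · exact h'
    · exact absurd h' hn0
  have hleaf : ∀ τ : ℝ, γ τ ∈ hotSet v ∧ Literature.Analysis.FluidPDE.curl (v (-1)) (γ τ) ≠ 0 ∧ lapH v (γ τ) = 0 ∧ HFlat v (γ τ) := fun τ =>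
    ⟨(hridge τ).1, (hridge τ).2.1, hflatall τ, hR20 C v hP (γ τ) (hridge τ).1 (hflatall τ)⟩
  have halone := hR18 C v hP hFL hR4
  obtain ⟨hinj, htop, hbot⟩ := hR19 C v hP hcl hR3 halone γ hγ' hridge
  rcases htop with htop | ⟨q, hq, hqH, hqω, hqL⟩
  · rcases hbot with hbot | ⟨q, hq, hqH, hqω, hqL⟩
    · exact hEsc C v W hP hT hK hFL hcl hcrit hR3 hR4 ⟨γ₀, ε, hε, hγ0, hω0, hγ, hflat⟩ hpin
        ⟨γ, hγ0mem, hω0', hγ', hleaf, hinj, htop, hbot⟩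
    · exact hCap C v W hP hT hK hFL hcl hcrit hR3 hR4 ⟨γ₀, ε, hε, hγ0, hω0, hγ, hflat⟩ hpin
        ⟨γ, hγ0mem, hω0', hγ', hleaf, hinj, q, Or.inr hq, hqH, hqω, hR20 C v hP q hqH hqL⟩
  · exact hCap C v W hP hT hK hFL hcl hcrit hR3 hR4 ⟨γ₀, ε, hε, hγ0, hω0, hγ, hflat⟩ hpin
      ⟨γ, hγ0mem, hω0', hγ', hleaf, hinj, q, Or.inl hq, hqH, hqω, hR20 C v hP q hqH hqL⟩

/-- **FLAT LEAF (DERIVED in v1.3)** ⇐ R15 ∧ R16 ∧ R18 ∧ R19 ∧ R20 ∧ FLAT-ESCAPING ∧ FLAT-CAPTURED; v1–v1.2 had it as a research stub (name kept). -/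
theorem stub_cellFlatLeaf : CellFlatLeaf :=
  cellFlatLeaf_of_ends stub_vortexLineGlobal stub_leafGlobalLaw stub_hotRegularAlone stub_leafEnds stub_hotFlatPointHFlat
    stub_cellFlatEscaping stub_cellFlatCaptured

/-! ## Kernel: C2a′ ⇐ R8 ∧ R9 ∧ R10 ∧ R11 ∧ FLAT ∧ MORSE (sorry-free; the split on `Δₕv₂(γ 0) = 0` is GLUED by the ridge invariant) -/

/-- **KERNEL `cellC2aRidge_of_leaf : RidgeInvariant → HotLapSign → HotTimePin → CurtainInvariant → CellFlatLeaf → CellMorseLeaf → C2a′`** — the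
statement of hot_split's `stub_cellC2aRidge` (v1.6, VERBATIM) from the two leaf cells; every structure stub is consumed.  Real arithmetic only. -/
theorem cellC2aRidge_of_leaf (hR8 : RidgeInvariant) (hR9 : HotLapSign) (hR10 : HotTimePin) (hR11 : CurtainInvariant)
    (hFlat : CellFlatLeaf) (hMorse : CellMorseLeaf) :
    ∀ (C : ℝ) (v : ℝ → EuclideanSpace ℝ (Fin 3) → EuclideanSpace ℝ (Fin 3)) (W : Set (ℝ × EuclideanSpace ℝ (Fin 3))),
      Pinned C v → ThickWindow v W → Peakless v →
      (∀ s < 0, ∀ y, ⟪fderiv ℝ (v s) y (Literature.Analysis.FluidPDE.curl (v s) y), EuclideanSpace.single 2 1⟫_ℝ = 0) →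
      IsClosed (hotSet v) → (∀ y ∈ hotSet v, fderiv ℝ (fun x => v (-1) x 2) y = 0) →
      (∀ K O : Set (EuclideanSpace ℝ (Fin 3)), IsCompact K → K.Nonempty → K ⊆ hotSet v → IsOpen O → K ⊆ O →
        O ∩ hotSet v ⊆ K → False) →
      (∀ y ∈ hotSet v, ∀ r : ℝ, 0 < r →
        ∃ y' : EuclideanSpace ℝ (Fin 3), y' 2 = 0 ∧ dist y' y < r ∧ v (-1) y' 2 ≠ v (-1) 0 2) →
      (∃ (γ : ℝ → EuclideanSpace ℝ (Fin 3)) (ε : ℝ), 0 < ε ∧ γ 0 ∈ hotSet v ∧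
        Literature.Analysis.FluidPDE.curl (v (-1)) (γ 0) ≠ 0 ∧
        ∀ τ ∈ Set.Ioo (-ε) ε, HasDerivAt γ (Literature.Analysis.FluidPDE.curl (v (-1)) (γ τ)) τ ∧ γ τ ∈ hotSet v) →
      False := by
  intro C v W hP hT hK hFL hcl hcrit hR3 hR4 harc
  obtain ⟨γ, ε, hε, hγ0, hω0, hγ⟩ := harc
  have hArc : IsHotArc v γ ε := ⟨hε, hγ0, hω0, hγ⟩
  have hinv := hR8 C v hP hFL γ ε hArc
  have hpin : ∀ y ∈ hotSet v, deriv (fun s => v s y 2) (-1) = v (-1) 0 2 / 2 := hR10 C v hP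
  have hn0 : ‖Literature.Analysis.FluidPDE.curl (v (-1)) (γ 0)‖ ^ 2 ≠ 0 := by
    have : ‖Literature.Analysis.FluidPDE.curl (v (-1)) (γ 0)‖ ≠ 0 := norm_ne_zero_iff.mpr hω0
    positivity
  by_cases h0 : lapH v (γ 0) = 0
  · -- FLAT: the ridge invariant propagates `Δₕv₂ = 0` along the arc
    refine hFlat C v W hP hT hK hFL hcl hcrit hR3 hR4 ⟨γ, ε, hε, hγ0, hω0, hγ, ?_⟩ hpin
    intro τ hτ
    have h := hinv τ hτ
    rw [h0, zero_mul] at h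
    rcases mul_eq_zero.mp h with h' | h'
    · exact h'
    · exact absurd h' hn0
  · -- MORSE: `Δₕv₂ = c‖ω‖²` along the arc with `c := Δₕv₂(γ 0)/‖ω(γ 0)‖²`, and `N·c < 0` by R9
    refine hMorse C v W hP hT hK hFL hcl hcrit hR3 hR4 ⟨γ, ε, hε, hγ0, hω0, hγ, ?_, hR11 C v hP hFL γ ε hArc h0⟩ hpin
    have hpos : 0 < ‖Literature.Analysis.FluidPDE.curl (v (-1)) (γ 0)‖ ^ 2 := by positivity
    refine ⟨lapH v (γ 0) / ‖Literature.Analysis.FluidPDE.curl (v (-1)) (γ 0)‖ ^ 2, ?_, ?_⟩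
    · have hsign : v (-1) 0 2 * lapH v (γ 0) ≤ 0 := hR9 C v hP (γ 0) hγ0
      have hN : v (-1) 0 2 ≠ 0 := hP.2.2.2.2.2.1
      have hlt : v (-1) 0 2 * lapH v (γ 0) < 0 := lt_of_le_of_ne hsign (mul_ne_zero hN h0)
      rw [← mul_div_assoc]
      exact div_neg_of_neg_of_pos hlt hpos
    · intro τ hτ
      have h := hinv τ hτ
      field_simp
      linarith [h]

/-- **Residue C2a′ (hot_split `stub_cellC2aRidge`, VERBATIM statement) on this line** ⇐ R8 ∧ R9 ∧ R10 ∧ R11 ∧ FLAT ∧ MORSE. -/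
theorem stub_cellC2aRidge :
    ∀ (C : ℝ) (v : ℝ → EuclideanSpace ℝ (Fin 3) → EuclideanSpace ℝ (Fin 3)) (W : Set (ℝ × EuclideanSpace ℝ (Fin 3))),
      Pinned C v → ThickWindow v W → Peakless v →
      (∀ s < 0, ∀ y, ⟪fderiv ℝ (v s) y (Literature.Analysis.FluidPDE.curl (v s) y), EuclideanSpace.single 2 1⟫_ℝ = 0) →
      IsClosed (hotSet v) → (∀ y ∈ hotSet v, fderiv ℝ (fun x => v (-1) x 2) y = 0) →
      (∀ K O : Set (EuclideanSpace ℝ (Fin 3)), IsCompact K → K.Nonempty → K ⊆ hotSet v → IsOpen O → K ⊆ O →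
        O ∩ hotSet v ⊆ K → False) →
      (∀ y ∈ hotSet v, ∀ r : ℝ, 0 < r →
        ∃ y' : EuclideanSpace ℝ (Fin 3), y' 2 = 0 ∧ dist y' y < r ∧ v (-1) y' 2 ≠ v (-1) 0 2) →
      (∃ (γ : ℝ → EuclideanSpace ℝ (Fin 3)) (ε : ℝ), 0 < ε ∧ γ 0 ∈ hotSet v ∧
        Literature.Analysis.FluidPDE.curl (v (-1)) (γ 0) ≠ 0 ∧
        ∀ τ ∈ Set.Ioo (-ε) ε, HasDerivAt γ (Literature.Analysis.FluidPDE.curl (v (-1)) (γ τ)) τ ∧ γ τ ∈ hotSet v) →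
      False :=
  cellC2aRidge_of_leaf stub_ridgeInvariant stub_hotLapSign stub_hotTimePin stub_curtainInvariant stub_cellFlatLeaf stub_cellMorseLeaf

/-! ## The other residue and the shared research stubs (VERBATIM hot_split v1.6) -/

/-- **Residue C2b′ `stub_cellC2bRidge` — THE NULL RIDGE ⇒ ∅ (OPEN, research) — VERBATIM hot_split v1.6.**  Not touched by this line. -/
theorem stub_cellC2bRidge :
    ∀ (C : ℝ) (v : ℝ → EuclideanSpace ℝ (Fin 3) → EuclideanSpace ℝ (Fin 3)) (W : Set (ℝ × EuclideanSpace ℝ (Fin 3))),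
      Pinned C v → ThickWindow v W → Peakless v →
      (∀ s < 0, ∀ y, ⟪fderiv ℝ (v s) y (Literature.Analysis.FluidPDE.curl (v s) y), EuclideanSpace.single 2 1⟫_ℝ = 0) →
      IsClosed (hotSet v) → (∀ y ∈ hotSet v, fderiv ℝ (fun x => v (-1) x 2) y = 0) →
      (∀ K O : Set (EuclideanSpace ℝ (Fin 3)), IsCompact K → K.Nonempty → K ⊆ hotSet v → IsOpen O → K ⊆ O →
        O ∩ hotSet v ⊆ K → False) →
      (∀ y ∈ hotSet v, ∀ r : ℝ, 0 < r →
        ∃ y' : EuclideanSpace ℝ (Fin 3), y' 2 = 0 ∧ dist y' y < r ∧ v (-1) y' 2 ≠ v (-1) 0 2) →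
      (∀ y ∈ hotSet v, Literature.Analysis.FluidPDE.curl (v (-1)) y = 0) →
      False := by
  sorry

/-- **SHARED STUB S0 ((TH) column) — VERBATIM `stub_localTHEmptyHypNUGRS`** (twist_split = hot_loops v4.3 = loop_island = hot_split). -/
theorem stub_localTHEmptyHypNUGRS :
    ∀ (u : ℝ → EuclideanSpace ℝ (Fin 3) → EuclideanSpace ℝ (Fin 3)) (μ A : ℝ → ℝ → ℝ)
      (U : Set (ℝ × EuclideanSpace ℝ (Fin 3))) (p₀ : ℝ × EuclideanSpace ℝ (Fin 3)),
      IsOpen U → p₀ ∈ U →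
      AnalyticOnNhd ℝ (Function.uncurry u) U →
      (∀ p ∈ U, AnalyticAt ℝ (Function.uncurry μ) (p.1, p.2 2)) →
      (∀ p ∈ U, AnalyticAt ℝ (Function.uncurry A) (p.1, p.2 2)) →
      (∀ p ∈ U, fderiv ℝ (u p.1) p.2 (EuclideanSpace.single 0 1) 1 = fderiv ℝ (u p.1) p.2 (EuclideanSpace.single 1 1) 0) →
      (∀ p ∈ U, fderiv ℝ (u p.1) p.2 (EuclideanSpace.single 0 1) 0 + fderiv ℝ (u p.1) p.2 (EuclideanSpace.single 1 1) 1 +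
        fderiv ℝ (u p.1) p.2 (EuclideanSpace.single 2 1) 2 = 0) →
      (∀ p ∈ U, ∀ b : Fin 3, b ≠ 2 →
        fderiv ℝ (u p.1) p.2 (EuclideanSpace.single 2 1) b =
          μ p.1 (p.2 2) * fderiv ℝ (u p.1) p.2 (EuclideanSpace.single b 1) 2) →
      (∀ p ∈ U,
        (1 - μ p.1 (p.2 2)) *
            (deriv (fun s => u s p.2 2) p.1 + fderiv ℝ (fun y => u p.1 y 2) p.2 (u p.1 p.2)
              - Δ (fun y => u p.1 y 2) p.2) =
          A p.1 (p.2 2) + (deriv (fun s => μ s (p.2 2)) p.1 - deriv (deriv (μ p.1)) (p.2 2)) * u p.1 p.2 2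
            + deriv (μ p.1) (p.2 2) / 2 * u p.1 p.2 2 ^ 2
            - 2 * deriv (μ p.1) (p.2 2) * fderiv ℝ (u p.1) p.2 (EuclideanSpace.single 2 1) 2) →
      fderiv ℝ (fun y => fderiv ℝ (u p₀.1) y (EuclideanSpace.single 2 1) 2) p₀.2 (EuclideanSpace.single 0 1) *
            fderiv ℝ (u p₀.1) p₀.2 (EuclideanSpace.single 1 1) 2 -
          fderiv ℝ (fun y => fderiv ℝ (u p₀.1) y (EuclideanSpace.single 2 1) 2) p₀.2 (EuclideanSpace.single 1 1) *
            fderiv ℝ (u p₀.1) p₀.2 (EuclideanSpace.single 0 1) 2 ≠ 0 →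
      μ p₀.1 (p₀.2 2) ≠ 0 → μ p₀.1 (p₀.2 2) ≠ 1 → deriv (μ p₀.1) (p₀.2 2) ≠ 0 →
      μ p₀.1 (p₀.2 2) < 0 →
      (fderiv ℝ (u p₀.1) p₀.2 (EuclideanSpace.single 0 1) 0 ≠ fderiv ℝ (u p₀.1) p₀.2 (EuclideanSpace.single 1 1) 1 ∨
        fderiv ℝ (u p₀.1) p₀.2 (EuclideanSpace.single 1 1) 0 ≠ 0) →
      u p₀.1 p₀.2 = 0 →
      fderiv ℝ (u p₀.1) p₀.2 (EuclideanSpace.single 0 1) 2 = 0 →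
      fderiv ℝ (u p₀.1) p₀.2 (EuclideanSpace.single 1 1) 2 = 1 → False := by
  sorry

/-- **THE WALL ⟨27893⟩ BY NAME (`stub_wall`)** — item `LoopPeriodRatchet.FrequencyGrowthExponent` (rank 2, OPEN); feeds the landed reduction only. -/
theorem stub_wall : FrequencyGrowthExponent := by
  sorry

/-! ## Kernel: HL3′ ⇐ cells, with A1, C1, C2a ⇐ C2a′, C2b ⇐ C2b′ ALL BY NAME from Theorems (K2-p2 g12/g13 landings) -/

/-- **HL3′ (the statement of `stub_peaklessEmpty`, hot_loops v4.3 / hot_split, VERBATIM) on this line**: hot_split's trichotomy with A1 :=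
`…HotPlaneConst.stub_hotPlaneConst`, C1 := `…ZeroModeNoHotPlane.hotSplit_cellC1`, C2a := `…HotSplitRidgeKernels.cellC2a_of_ridge stub_cellC2aRidge`,
C2b := `…HotSplitRidgeKernels.cellC2b_of_ridge stub_cellC2bRidge`, the frozen law from `…FirstIntegral.stub_firstIntegral`.  Kernel-checked. -/
theorem leafUniform_peaklessEmpty :
    ∀ (C : ℝ) (v : ℝ → EuclideanSpace ℝ (Fin 3) → EuclideanSpace ℝ (Fin 3)),
      Literature.Analysis.FluidPDE.HasTypeITimeDecay C v →
      ContinuousOn (Function.uncurry v) (Set.Iio (0 : ℝ) ×ˢ Set.univ) →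
      (∀ s t : ℝ, s < t → t < 0 → ∀ x, v t x =
        Literature.Analysis.UnboundedOperators.heatExtension (v s) (t - s) x -
          Literature.Analysis.FluidPDE.oseenDuhamel 1 s v v t x) →
      (∀ t < 0, Literature.Analysis.FluidPDE.VectorCalculus.IsDivFree (v t)) →
      (∀ s < 0, ∀ y, ⟪Literature.Analysis.FluidPDE.curl (v s) y, EuclideanSpace.single 2 1⟫_ℝ = 0) →
      v (-1) 0 2 ≠ 0 → (∀ t < 0, ∀ x, Real.sqrt (-t) * |v t x 2| ≤ |v (-1) 0 2|) →
      (∀ h : EuclideanSpace ℝ (Fin 3), fderiv ℝ (v (-1)) 0 h 2 = 0) →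
      (deriv (fun s => v s 0 2) (-1) = v (-1) 0 2 / 2 ∧ v (-1) 0 2 * (Δ (fun y => v (-1) y 2)) 0 ≤ 0) →
      ∀ W : Set (ℝ × EuclideanSpace ℝ (Fin 3)), IsOpen W → W ⊆ Set.Iio (0 : ℝ) ×ˢ Set.univ →
        (∀ z ∈ W, (Literature.Analysis.FluidPDE.curl (v z.1) z.2 ≠ 0 ∧
            (fderiv ℝ (v z.1) z.2 (EuclideanSpace.single 0 1) 2 ≠ 0 ∨ fderiv ℝ (v z.1) z.2 (EuclideanSpace.single 1 1) 2 ≠ 0) ∧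
            (fderiv ℝ (v z.1) z.2 (EuclideanSpace.single 2 1) 0 ≠ 0 ∨ fderiv ℝ (v z.1) z.2 (EuclideanSpace.single 2 1) 1 ≠ 0)) ∧
          (fderiv ℝ (fun x => fderiv ℝ (v z.1) x (EuclideanSpace.single 2 1) 2) z.2 (EuclideanSpace.single 0 1) *
                fderiv ℝ (v z.1) z.2 (EuclideanSpace.single 1 1) 2 -
              fderiv ℝ (fun x => fderiv ℝ (v z.1) x (EuclideanSpace.single 2 1) 2) z.2 (EuclideanSpace.single 1 1) *
                fderiv ℝ (v z.1) z.2 (EuclideanSpace.single 0 1) 2 ≠ 0)) →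
        (∀ m : ℝ → ℝ → ℝ, ∀ W₁ : Set (ℝ × EuclideanSpace ℝ (Fin 3)), W₁ ⊆ W → IsOpen W₁ → W₁.Nonempty →
            ∃ z ∈ W₁, ∃ b : Fin 3, b ≠ 2 ∧
              fderiv ℝ (v z.1) z.2 (EuclideanSpace.single 2 1) b ≠
                m z.1 (z.2 2) * fderiv ℝ (v z.1) z.2 (EuclideanSpace.single b 1) 2) →
        (∀ r : ℝ, 0 < r → (Metric.ball ((-1 : ℝ), (0 : EuclideanSpace ℝ (Fin 3))) r ∩ W).Nonempty) →
        (∀ (s z₀ σ M : ℝ) (K O : Set (EuclideanSpace ℝ (Fin 3))), s < 0 →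
          ((σ = 1 ∨ σ = -1) ∧ IsCompact K ∧ K.Nonempty ∧ (∀ y ∈ K, y 2 = z₀ ∧ σ * v s y 2 = M) ∧
            IsOpen O ∧ K ⊆ O ∧ (∀ y ∈ O, y 2 = z₀ → σ * v s y 2 ≤ M) ∧
            (∀ y ∈ O, y 2 = z₀ → σ * v s y 2 = M → y ∈ K)) → False) →
        False :=
  -- v1.1 (critic A1): HL3′ ⇐ C2a′ ∧ C2b′ BY NAME through the tree's `…HotSplitCells.peaklessEmpty_of_ridges` (K2-p2 g13, p690711);
  -- `Pinned`/`ThickWindow`/`Peakless`/`hotSet` unfold definitionally to the Theorems file's verbatim binders.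
  PoloidalWindowDoorPoloidalWindowRigidityHotSplitCells.peaklessEmpty_of_ridges stub_cellC2aRidge stub_cellC2bRidge

/-! ## Compositions to the crux items BY NAME -/

/-- **The crux `PoloidalWindowRigidity` (K2, stmt-NavierStokesRegularity-19708) BY NAME ⇐ S0 ∧ ⟨27893⟩ ∧ R8–R11 ∧ FLAT ∧ MORSE ∧ C2b′**: tree
`…HotSplitComposition.poloidalWindowRigidity_of_residues` (v1.1; v1 went through `…HotLoopsReduction…` + this file's HL3′).  CONDITIONAL; no summit is proved. -/
theorem PoloidalWindowRigidity_of_leafUniform :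
    Summit.NavierStokesRegularity.NavierStokesRegularity.Theses.PoloidalWindowDoor.PoloidalWindowRigidity :=
  -- v1.1 (critic A1): `leafUniform_peaklessEmpty` is HL3′ BY NAME through `…HotSplitCells.peaklessEmpty_of_ridges`; this term is definitionally the tree's
  -- `…HotSplitComposition.poloidalWindowRigidity_of_residues stub_localTHEmptyHypNUGRS stub_wall stub_cellC2aRidge stub_cellC2bRidge` (see the `example`s below).
  PoloidalWindowDoorPoloidalWindowRigidityHotLoopsReduction.poloidalWindowRigidity_of_NUGRS_of_growth_of_peakless
    stub_localTHEmptyHypNUGRS stub_wall leafUniform_peaklessEmpty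

/-- **The item `LrcModEntire` (stmt-NavierStokesRegularity-20428) BY NAME ⇐ S0 ∧ ⟨27893⟩ ∧ R8–R11 ∧ FLAT ∧ MORSE ∧ C2b′.** CONDITIONAL. -/
theorem LrcModEntire_of_leafUniform :
    Summit.NavierStokesRegularity.NavierStokesRegularity.Theses.PoloidalWindowDoor.LrcModEntire :=
  PoloidalWindowDoorPoloidalWindowRigidityHotLoopsReduction.lrcModEntire_of_NUGRS_of_growth_of_peakless
    stub_localTHEmptyHypNUGRS stub_wall leafUniform_peaklessEmpty

/-- v1.1 (critic A1): the same two compositions through the tree's `…HotSplitComposition…_of_residues` BY NAME (S0, wall, C2a′, C2b′ — the residue of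
this line being the DERIVED one); `example`s, so the census reads them and the audit counts no duplicate items. -/
example : Summit.NavierStokesRegularity.NavierStokesRegularity.Theses.PoloidalWindowDoor.PoloidalWindowRigidity :=
  PoloidalWindowDoorPoloidalWindowRigidityHotSplitComposition.poloidalWindowRigidity_of_residues
    stub_localTHEmptyHypNUGRS stub_wall stub_cellC2aRidge stub_cellC2bRidge

example : Summit.NavierStokesRegularity.NavierStokesRegularity.Theses.PoloidalWindowDoor.LrcModEntire :=
  PoloidalWindowDoorPoloidalWindowRigidityHotSplitComposition.lrcModEntire_of_residues
    stub_localTHEmptyHypNUGRS stub_wall stub_cellC2aRidge stub_cellC2bRidge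

end Summit.NavierStokesRegularity.NavierStokesRegularity.Cruxes.PoloidalWindowRigidity.LeafUniform
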